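import Literature.NumberTheory.Transcendental.RoyCriterion
import Mathlib.Analysis.Complex.Liouville
import Mathlib.Analysis.SpecialFunctions.ExpDeriv
import Mathlib.Analysis.SpecialFunctions.Pow.Real
import Mathlib.Analysis.SpecialFunctions.Pow.Asymptotics
import Mathlib.FieldTheory.IntermediateField.Basic
import Mathlib.Analysis.Complex.TaylorSeries
import Mathlib.Analysis.Matrix.Normed
import Mathlib.NumberTheory.SiegelsLemma
import HarnessLib

/-!
# Roy's criterion — the equivalence with Schanuel's conjecture (Roy 2001, §§1, 4, 5)

Topic: `Literature/NumberTheory/Transcendental`. Companion of `RoyCriterion.lean`; works towards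
the discharge of the named fact `Literature.NumberTheory.Transcendental.Roy2001_iff` (`provefact-Literature.Transcend.Roy2001_iff`).

## Content (verified against the printed text of Roy 2001, pp. 183–194)

The printed proof of the equivalence `Conjecture 2 (rank l) ⇔ Conjecture 1 (rank l)` (Roy 2001,
§5, p. 193–194) rests on two inputs which are *not* in Mathlib:

* `Roy2001_thm3` — **Theorem 3 (M. Waldschmidt)** of Roy 2001, §4, p. 190, a special case of
  Waldschmidt 1981, Thm. 3.1: the auxiliary polynomial `P ∈ ℤ[X₀, X₁]` with `|P(z, e^z)|_r ≤ e^{-U}`.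
  Named fact.
* `Roy2001_thm1` — **Theorem 1** of Roy 2001, p. 184: for `(y, α) ∈ ℂ × ℂˣ` and admissible
  parameters, `(a) ∃ d ≥ 1, α^d = e^{dy}` iff `(b) RoyConditionB y α …`. Named fact; it is the
  conjunction of **Proposition 2** (p. 191, `(a) ⇒ (b)`, from Theorem 3) and **Proposition 3**
  (p. 192, `¬(a) ⇒ ¬(b)`, from the interpolation Theorem 2 and Lemma 4), both vendored as named
  facts `Roy2001_prop2`, `Roy2001_prop3`, and `Roy2001_thm1_of` assembles them (proved).

What is **proved** here:

* `hasDerivAt_expEval`, `iteratedDeriv_expEval` — `d^k/dz^k P(z, e^z) = (D^k P)(z, e^z)` for Roy's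
  derivation `D = ∂/∂X₀ + X₁ ∂/∂X₁` (Roy 2001, p. 191, "`d^k g_N/dz^k (z) = (D^k Q_N)(z, ζ^m e^z)`").
* `Roy2001_thm1_of : Roy2001_prop2 → Roy2001_prop3 → Roy2001_thm1` (Roy 2001, §4).
* `royCriterion_of_schanuelRank : Roy2001_thm1 → SchanuelRank l → RoyCriterion l`
  (Roy 2001, §5, 1°).
* `schanuelRank_of_royCriterion : Roy2001_thm3 → RoyCriterion l → SchanuelRank l`
  (Roy 2001, §5, 2°), including the parameter bookkeeping `Δ = N`, `r = 1 + cN^{s₁}`,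
  `T₀ = N^{t₀}`, `T₁ = N^{t₁}`, `U = 2N^u` and the Cauchy estimate `k! e^{-2N^u} ≤ e^{-N^u}`.
* `Roy2001_iff_of : Roy2001_thm3 → Roy2001_thm1 → Roy2001_iff` — the §5 assembly.
* `exists_royAuxPoly` — a Thue–Siegel–Waldschmidt auxiliary polynomial with weaker constants
  (Siegel's lemma on the Taylor coefficients of `P(z, e^z)` at `0` + Schwarz lemma), which is all
  §5, 2° needs from Theorem 3; hence `schanuelRank_of_royCriterion' : RoyCriterion l →
  SchanuelRank l` **unconditionally**, and `Roy2001_iff_of_prop3 : Roy2001_prop3 → Roy2001_iff`.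
  So `Roy2001_iff_holds` will follow once Proposition 3 (via the interpolation Theorem 2) is
  discharged (plan in the session NOTES of `provefact-Literature.Transcend.Roy2001_iff`).
* `Roy2001_lemma4` — Lemma 4 of Roy 2001 (proved).

## Sources

* D. Roy, *An arithmetic criterion for the values of the exponential function*, Acta Arith. 97
  (2001), 183–194. [Roy2001]
* M. Waldschmidt, *Transcendance et exponentielles en plusieurs variables*, Invent. Math. 63
  (1981), 97–127, Thm. 3.1. [Waldschmidt1981]

## Design choices

* `|f|_r` (Roy: the sup of `|f|` on `|z| = r`, equal to the sup on `|z| ≤ r` by the maximum modulus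
  principle, p. 185) is rendered as the pointwise bound `∀ z, ‖z‖ ≤ r → ‖f z‖ ≤ …` on the closed disc.
* Condition (a) of Theorem 1, "`α e^{-y}` is a root of unity" in Propositions 2–3, is written
  uniformly as `∃ d : ℕ, 1 ≤ d ∧ α ^ d = cexp (d * y)`; `royCondA_iff` records the equivalence with
  the root-of-unity phrasing.
-/

noncomputable section

open MvPolynomial Filter Complex Metric Asymptotics Matrix

namespace Literature.NumberTheory.Transcendental

/-! ### Statements (named facts) -/

/-- Condition **(b)** of Roy 2001, Theorem 1, for the pair `(y, α)` and parameters
`(s₀, s₁, t₀, t₁, u)`: for every sufficiently large positive integer `N` there is a non-zero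
`Q_N ∈ ℤ[X₀, X₁]` of partial degree `≤ N^{t₀}` in `X₀`, `≤ N^{t₁}` in `X₁`, height `≤ e^N`, with
`|(D^k Q_N)(m y, α^m)| ≤ exp(-N^u)` for all `k, m ∈ ℕ` with `k ≤ N^{s₀}`, `m ≤ N^{s₁}`.
[cite: Roy2001, Thm. 1 (b)] -/
def RoyConditionB (y α : ℂ) (s₀ s₁ t₀ t₁ u : ℝ) : Prop :=
  ∀ᶠ N : ℕ in atTop, ∃ Q : MvPolynomial (Fin 2) ℤ, Q ≠ 0 ∧
    (Q.degreeOf 0 : ℝ) ≤ (N : ℝ) ^ t₀ ∧ (Q.degreeOf 1 : ℝ) ≤ (N : ℝ) ^ t₁ ∧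
    (mvPolyHeight Q : ℝ) ≤ Real.exp N ∧
    ∀ k m : ℕ, (k : ℝ) ≤ (N : ℝ) ^ s₀ → (m : ℝ) ≤ (N : ℝ) ^ s₁ →
      ‖aeval ![(m : ℂ) * y, α ^ m] (royD^[k] Q)‖ ≤ Real.exp (-(N : ℝ) ^ u)

/-- Condition **(a)** of Roy 2001, Theorem 1: there is an integer `d ≥ 1` with `α^d = e^{dy}`
(equivalently, `α e^{-y}` is a root of unity, see `royCondA_iff`). [cite: Roy2001, Thm. 1 (a)] -/
def RoyConditionA (y α : ℂ) : Prop :=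
  ∃ d : ℕ, 1 ≤ d ∧ α ^ d = cexp (d * y)

/-- NAMED FACT — **Roy 2001, Theorem 1**: for `(y, α) ∈ ℂ × ℂˣ` and positive `s₀, s₁, t₀, t₁, u`
satisfying (1), conditions (a) and (b) are equivalent. [cite: Roy2001, Thm. 1] -/
def Roy2001_thm1 : Prop :=
  ∀ (y α : ℂ), α ≠ 0 → ∀ (s₀ s₁ t₀ t₁ u : ℝ), RoyAdmissible s₀ s₁ t₀ t₁ u →
    (RoyConditionA y α ↔ RoyConditionB y α s₀ s₁ t₀ t₁ u)

/-- NAMED FACT — **Roy 2001, Proposition 2**: for `(y, α) ∈ ℂ × ℂˣ` and positive parameters with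
`max{1, s₀, t₀, s₁ + t₁} < u < ½ (1 + t₀ + t₁)`, if `α e^{-y}` is a root of unity then condition
(b) of Theorem 1 holds. (Proved in print from Theorem 3.) [cite: Roy2001, Prop. 2] -/
def Roy2001_prop2 : Prop :=
  ∀ (y α : ℂ), α ≠ 0 → ∀ (s₀ s₁ t₀ t₁ u : ℝ), 0 < s₀ → 0 < s₁ → 0 < t₀ → 0 < t₁ → 0 < u →
    max 1 (max s₀ (max t₀ (s₁ + t₁))) < u → u < (1 + t₀ + t₁) / 2 →
    RoyConditionA y α → RoyConditionB y α s₀ s₁ t₀ t₁ u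

/-- NAMED FACT — **Roy 2001, Proposition 3**: for `(y, α) ∈ ℂ × ℂˣ` and positive parameters with
`max{1, t₀, 2t₁} < min{s₀, 2s₁} < u`, if `α e^{-y}` is not a root of unity then condition (b) of
Theorem 1 fails. (Proved in print from the interpolation Theorem 2 and Lemma 4.)
[cite: Roy2001, Prop. 3] -/
def Roy2001_prop3 : Prop :=
  ∀ (y α : ℂ), α ≠ 0 → ∀ (s₀ s₁ t₀ t₁ u : ℝ), 0 < s₀ → 0 < s₁ → 0 < t₀ → 0 < t₁ → 0 < u →
    max 1 (max t₀ (2 * t₁)) < min s₀ (2 * s₁) → min s₀ (2 * s₁) < u →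
    ¬ RoyConditionA y α → ¬ RoyConditionB y α s₀ s₁ t₀ t₁ u

/-- NAMED FACT — **Roy 2001, Theorem 3 (M. Waldschmidt; special case of Waldschmidt 1981,
Thm. 3.1)**: let `Δ, r, T₀, T₁, U > 0` with `U ≥ 3`,
`log((T₀ + 1)(T₁ + 1)) + Δ + T₀ log(e r) + e r T₁ ≤ U` and `(8U)² ≤ Δ T₀ T₁`. Then there is a
non-zero `P ∈ ℤ[X₀, X₁]` of partial degree `≤ T₀` in `X₀`, `≤ T₁` in `X₁`, height `≤ e^Δ`, such
that `f(z) = P(z, e^z)` satisfies `|f|_r ≤ e^{-U}` (sup over `|z| ≤ r`).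
[cite: Roy2001, Thm. 3; Waldschmidt1981, Thm. 3.1] -/
def Roy2001_thm3 : Prop :=
  ∀ (Δ r T₀ T₁ U : ℝ), 0 < Δ → 0 < r → 0 < T₀ → 0 < T₁ → 3 ≤ U →
    Real.log ((T₀ + 1) * (T₁ + 1)) + Δ + T₀ * Real.log (Real.exp 1 * r) + Real.exp 1 * r * T₁ ≤ U →
    (8 * U) ^ 2 ≤ Δ * T₀ * T₁ →
    ∃ P : MvPolynomial (Fin 2) ℤ, P ≠ 0 ∧ (P.degreeOf 0 : ℝ) ≤ T₀ ∧ (P.degreeOf 1 : ℝ) ≤ T₁ ∧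
      (mvPolyHeight P : ℝ) ≤ Real.exp Δ ∧
      ∀ z : ℂ, ‖z‖ ≤ r → ‖aeval ![z, cexp z] P‖ ≤ Real.exp (-U)

/-! ### Condition (a) -/

/-- Condition (a) says exactly that `α e^{-y}` is a root of unity (Roy 2001, p. 191: "Write
`α = ζ e^y` … `ζ^d = 1`"). [cite: Roy2001, Prop. 2 (proof)] -/
theorem royCondA_iff (y α : ℂ) :
    RoyConditionA y α ↔ ∃ d : ℕ, 1 ≤ d ∧ (α * cexp (-y)) ^ d = 1 := by
  unfold RoyConditionA
  refine exists_congr fun d => and_congr Iff.rfl ?_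
  rw [mul_pow, ← Complex.exp_nat_mul, mul_neg, Complex.exp_neg,
    mul_inv_eq_one₀ (Complex.exp_ne_zero _)]

/-- Theorem 1 is the conjunction of Propositions 2 and 3 (Roy 2001, §4, p. 190: "We divide the
proof of Theorem 1 into two propositions"). [cite: Roy2001, §4] -/
theorem Roy2001_thm1_of (h₂ : Roy2001_prop2) (h₃ : Roy2001_prop3) : Roy2001_thm1 := by
  intro y α hα s₀ s₁ t₀ t₁ u hadm
  obtain ⟨hs₀, hs₁, ht₀, ht₁, hu, h1, h2, h3⟩ := hadm
  have hmax := max_lt_iff.1 h1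
  have hmax' := max_lt_iff.1 hmax.2
  have hmin₁ : min s₀ (2 * s₁) ≤ s₀ := min_le_left _ _
  have hs₀u : s₀ < u := lt_of_le_of_lt (le_max_left _ _) h2
  have hst : s₁ + t₁ < u := lt_of_le_of_lt (le_max_right _ _) h2
  constructor
  · intro ha
    refine h₂ y α hα s₀ s₁ t₀ t₁ u hs₀ hs₁ ht₀ ht₁ hu ?_ h3 ha
    refine max_lt (by linarith [hmax.1]) (max_lt hs₀u (max_lt (by linarith [hmax'.1]) hst))
  · intro hb
    by_contra ha
    exact h₃ y α hα s₀ s₁ t₀ t₁ u hs₀ hs₁ ht₀ ht₁ hu h1 (lt_of_le_of_lt hmin₁ hs₀u) ha hb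

/-! ### `d^k/dz^k P(z, e^z) = (D^k P)(z, e^z)` -/

/-- `f_P(z) = P(z, e^z)` for `P ∈ ℤ[X₀, X₁]` (Roy 2001, Thm. 3: "the function `f(z) = P(z, e^z)`").
[cite: Roy2001, Thm. 3] -/
def expEval (P : MvPolynomial (Fin 2) ℤ) (z : ℂ) : ℂ :=
  aeval ![z, cexp z] P

/-- Unfolding `expEval`. [cite: Roy2001, Thm. 3] -/
@[simp] theorem expEval_apply (P : MvPolynomial (Fin 2) ℤ) (z : ℂ) :
    expEval P z = aeval ![z, cexp z] P := rfl

/-- `royD` kills constants. [cite: Roy2001, §1] -/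
@[simp] theorem royD_C (a : ℤ) : royD (C a : MvPolynomial (Fin 2) ℤ) = 0 := by
  simp [royD]

/-- `d/dz P(z, e^z) = (D P)(z, e^z)` (chain rule; Roy 2001, p. 191). [cite: Roy2001, §4 (p. 191)] -/
theorem hasDerivAt_expEval (P : MvPolynomial (Fin 2) ℤ) (z : ℂ) :
    HasDerivAt (expEval P) (expEval (royD P) z) z := by
  induction P using MvPolynomial.induction_on with
  | C a =>
    have h1 : expEval (C a) = fun _ => (a : ℂ) := by ext w; simp [expEval]
    have h2 : expEval (royD (C a)) z = 0 := by simp only [expEval, royD_C, map_zero]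
    rw [h1, h2]
    exact hasDerivAt_const _ _
  | add p q hp hq =>
    have h1 : expEval (p + q) = fun w => expEval p w + expEval q w := by
      ext w; simp [expEval]
    have h2 : expEval (royD (p + q)) z = expEval (royD p) z + expEval (royD q) z := by
      simp [expEval]
    rw [h1, h2]
    exact hp.add hq
  | mul_X p i hp =>
    have key : ∀ j : Fin 2, j = 0 ∨ j = 1 := by decide
    rcases key i with rfl | rfl
    · have h1 : expEval (p * X 0) = fun w => expEval p w * w := by
        ext w; simp [expEval]
      have h2 : expEval (royD (p * X 0)) z = expEval (royD p) z * z + expEval p z * 1 := by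
        simp [expEval, royD_mul, map_add, map_mul]
      rw [h1, h2]
      exact hp.mul (hasDerivAt_id z)
    · have h1 : expEval (p * X 1) = fun w => expEval p w * cexp w := by
        ext w; simp [expEval]
      have h2 : expEval (royD (p * X 1)) z =
          expEval (royD p) z * cexp z + expEval p z * cexp z := by
        simp [expEval, royD_mul, map_add, map_mul]
      rw [h1, h2]
      exact hp.mul (Complex.hasDerivAt_exp z)

/-- `(P(z, e^z))' = (DP)(z, e^z)`. [cite: Roy2001, §4 (p. 191)] -/
theorem deriv_expEval (P : MvPolynomial (Fin 2) ℤ) : deriv (expEval P) = expEval (royD P) := by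
  ext z; exact (hasDerivAt_expEval P z).deriv

/-- `z ↦ P(z, e^z)` is entire. [cite: Roy2001, §4 (p. 191)] -/
theorem differentiable_expEval (P : MvPolynomial (Fin 2) ℤ) : Differentiable ℂ (expEval P) :=
  fun z => (hasDerivAt_expEval P z).differentiableAt

/-- `d^k/dz^k P(z, e^z) = (D^k P)(z, e^z)` (Roy 2001, p. 191 and p. 194).
[cite: Roy2001, §5 (p. 194)] -/
theorem iteratedDeriv_expEval (k : ℕ) (P : MvPolynomial (Fin 2) ℤ) :
    iteratedDeriv k (expEval P) = expEval (royD^[k] P) := by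
  induction k generalizing P with
  | zero => simp
  | succ k ih => rw [iteratedDeriv_succ', deriv_expEval, ih, Function.iterate_succ_apply]

/-- Cauchy's estimate on the disc of radius `1`: if `|P(z, e^z)| ≤ C` for `|z - z₀| = 1` then
`|(D^k P)(z₀, e^{z₀})| ≤ k! C` (Roy 2001, p. 194: "`≤ k! |f_N|_r`"). [cite: Roy2001, §5 (p. 194)] -/
theorem norm_expEval_iterate_royD_le (k : ℕ) (P : MvPolynomial (Fin 2) ℤ) (z₀ : ℂ) {C : ℝ}
    (hC : ∀ z ∈ sphere z₀ 1, ‖expEval P z‖ ≤ C) :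
    ‖expEval (royD^[k] P) z₀‖ ≤ k.factorial * C := by
  have h := Complex.norm_iteratedDeriv_le_of_forall_mem_sphere_norm_le (f := expEval P) k
    one_pos (differentiable_expEval P).diffContOnCl hC
  simpa [iteratedDeriv_expEval] using h

/-! ### Growth bookkeeping (Roy 2001, §5, 2°: the choice `Δ = N`, `r = 1 + cN^{s₁}`,
`T₀ = N^{t₀}`, `T₁ = N^{t₁}`, `U = 2N^u`) -/

/-- For `a < b` and `D > 0`, eventually `C x^a ≤ D x^b`. [folklore] -/
theorem eventually_mul_rpow_le_mul_rpow {a b : ℝ} (C : ℝ) {D : ℝ} (hab : a < b) (hD : 0 < D) :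
    ∀ᶠ x : ℝ in atTop, C * x ^ a ≤ D * x ^ b := by
  have h1 : ∀ᶠ x : ℝ in atTop, C / D ≤ x ^ (b - a) :=
    (tendsto_rpow_atTop (sub_pos.2 hab)).eventually_ge_atTop _
  filter_upwards [h1, eventually_gt_atTop 0] with x hx hx0
  have hxa : 0 ≤ x ^ a := Real.rpow_nonneg hx0.le a
  calc C * x ^ a = (C / D) * D * x ^ a := by field_simp
    _ ≤ x ^ (b - a) * D * x ^ a :=
        mul_le_mul_of_nonneg_right (mul_le_mul_of_nonneg_right hx hD.le) hxa
    _ = D * (x ^ (b - a) * x ^ a) := by ring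
    _ = D * x ^ b := by rw [← Real.rpow_add hx0, sub_add_cancel]

/-- For `0 < b` and `D > 0`, eventually `C ≤ D x^b`. [folklore] -/
theorem eventually_const_le_mul_rpow {b : ℝ} (C : ℝ) {D : ℝ} (hb : 0 < b) (hD : 0 < D) :
    ∀ᶠ x : ℝ in atTop, C ≤ D * x ^ b := by
  filter_upwards [eventually_mul_rpow_le_mul_rpow C hb hD] with x hx
  simpa [Real.rpow_zero] using hx

/-- For `a < b`, `0 ≤ C` and `D > 0`, eventually `C x^a log x ≤ D x^b`. [folklore] -/
theorem eventually_mul_rpow_mul_log_le {a b : ℝ} {C D : ℝ} (hab : a < b) (hC : 0 ≤ C)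
    (hD : 0 < D) : ∀ᶠ x : ℝ in atTop, C * x ^ a * Real.log x ≤ D * x ^ b := by
  set ε : ℝ := (b - a) / 2 with hε
  have hε0 : 0 < ε := by rw [hε]; linarith
  have hab' : a + ε < b := by rw [hε]; linarith
  filter_upwards [eventually_mul_rpow_le_mul_rpow (C / ε) hab' hD, eventually_gt_atTop 0]
    with x hx hx0
  have hlog : Real.log x ≤ x ^ ε / ε := Real.log_le_rpow_div hx0.le hε0
  have hxa : 0 ≤ C * x ^ a := mul_nonneg hC (Real.rpow_nonneg hx0.le a)
  calc C * x ^ a * Real.log x ≤ C * x ^ a * (x ^ ε / ε) := mul_le_mul_of_nonneg_left hlog hxa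
    _ = C / ε * x ^ (a + ε) := by rw [Real.rpow_add hx0]; field_simp
    _ ≤ D * x ^ b := hx

/-- The parameter bookkeeping of Roy 2001, §5, 2° (p. 193–194): for admissible parameters and
`c ≥ 0`, for all large `N` the numbers `Δ = N`, `r = 1 + cN^{s₁}`, `T₀ = N^{t₀}`, `T₁ = N^{t₁}`,
`U = 2N^u` satisfy the hypotheses of Theorem 3, and `k! e^{-2N^u} ≤ e^{-N^u}` for `k ≤ N^{s₀}`.
[cite: Roy2001, §5 (2°)] -/
theorem eventually_roy_params {s₀ s₁ t₀ t₁ u : ℝ} (h : RoyAdmissible s₀ s₁ t₀ t₁ u) {c : ℝ}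
    (hc : 0 ≤ c) :
    ∀ᶠ N : ℕ in atTop,
      3 ≤ 2 * (N : ℝ) ^ u ∧
      Real.log ((((N : ℝ) ^ t₀ + 1)) * ((N : ℝ) ^ t₁ + 1)) + N +
          (N : ℝ) ^ t₀ * Real.log (Real.exp 1 * (1 + c * (N : ℝ) ^ s₁)) +
          Real.exp 1 * (1 + c * (N : ℝ) ^ s₁) * (N : ℝ) ^ t₁ ≤ 2 * (N : ℝ) ^ u ∧
      (8 * (2 * (N : ℝ) ^ u)) ^ 2 ≤ (N : ℝ) * (N : ℝ) ^ t₀ * (N : ℝ) ^ t₁ ∧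
      ∀ k : ℕ, (k : ℝ) ≤ (N : ℝ) ^ s₀ →
        (k.factorial : ℝ) * Real.exp (-(2 * (N : ℝ) ^ u)) ≤ Real.exp (-(N : ℝ) ^ u) := by
  obtain ⟨hs₀, hs₁, ht₀, ht₁, hu, h1, h2, h3⟩ := h
  have hmax := max_lt_iff.1 h1
  have hmax' := max_lt_iff.1 hmax.2
  have h1s₀ : 1 < s₀ := lt_of_lt_of_le hmax.1 (min_le_left _ _)
  have ht₀s₀ : t₀ < s₀ := lt_of_lt_of_le hmax'.1 (min_le_left _ _)
  have hs₀u : s₀ < u := lt_of_le_of_lt (le_max_left _ _) h2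
  have hst : s₁ + t₁ < u := lt_of_le_of_lt (le_max_right _ _) h2
  have h1u : 1 < u := h1s₀.trans hs₀u
  have ht₀u : t₀ < u := ht₀s₀.trans hs₀u
  have ht₁u : t₁ < u := by linarith
  have h2u : 2 * u < 1 + t₀ + t₁ := by linarith
  set ε : ℝ := (u - t₀) / 2 with hε
  have hε0 : 0 < ε := by rw [hε]; linarith
  have ht₀ε : t₀ + ε < u := by rw [hε]; linarith
  have q0 : (0 : ℝ) < 1 / 4 := by norm_num
  -- the real-variable statement
  have H : ∀ᶠ x : ℝ in atTop,
      3 ≤ 2 * x ^ u ∧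
      Real.log (((x ^ t₀ + 1)) * (x ^ t₁ + 1)) + x +
          x ^ t₀ * Real.log (Real.exp 1 * (1 + c * x ^ s₁)) +
          Real.exp 1 * (1 + c * x ^ s₁) * x ^ t₁ ≤ 2 * x ^ u ∧
      (8 * (2 * x ^ u)) ^ 2 ≤ x * x ^ t₀ * x ^ t₁ ∧
      ∀ k : ℕ, (k : ℝ) ≤ x ^ s₀ →
        (k.factorial : ℝ) * Real.exp (-(2 * x ^ u)) ≤ Real.exp (-x ^ u) := by
    filter_upwards [eventually_ge_atTop (1 : ℝ),
      eventually_const_le_mul_rpow 3 hu two_pos,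
      eventually_const_le_mul_rpow (Real.log 4) hu q0,
      eventually_mul_rpow_le_mul_rpow (2 * (t₀ + t₁)) (show (1 / 2 : ℝ) < u by linarith) q0,
      eventually_mul_rpow_le_mul_rpow 1 h1u q0,
      eventually_mul_rpow_le_mul_rpow (1 + Real.log (1 + c)) ht₀u q0,
      eventually_mul_rpow_le_mul_rpow (s₁ / ε) ht₀ε q0,
      eventually_mul_rpow_le_mul_rpow (Real.exp 1) ht₁u q0,
      eventually_mul_rpow_le_mul_rpow (Real.exp 1 * c) hst q0,
      eventually_mul_rpow_le_mul_rpow 256 h2u one_pos,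
      eventually_mul_rpow_mul_log_le hs₀u hs₀.le one_pos]
      with x hx1 E0 E1 E2 E3 E4 E5 E6 E7 E8 E9
    have hx0 : 0 < x := one_pos.trans_le hx1
    have hxpos : ∀ t : ℝ, 0 < x ^ t := fun t => Real.rpow_pos_of_pos hx0 t
    have hx1t : ∀ {t : ℝ}, 0 ≤ t → 1 ≤ x ^ t := fun ht => Real.one_le_rpow hx1 ht
    have hlogx : 0 ≤ Real.log x := Real.log_nonneg hx1
    refine ⟨E0, ?_, ?_, ?_⟩
    · -- the main inequality: seven terms, each `≤ x^u / 4`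
      -- T1 : log((x^t₀+1)(x^t₁+1)) ≤ log 4 + (t₀+t₁) log x ≤ log 4 + 2(t₀+t₁) x^{1/2}
      have hT1 : Real.log ((x ^ t₀ + 1) * (x ^ t₁ + 1)) ≤
          Real.log 4 + 2 * (t₀ + t₁) * x ^ (1 / 2 : ℝ) := by
        have hle : (x ^ t₀ + 1) * (x ^ t₁ + 1) ≤ 4 * (x ^ t₀ * x ^ t₁) := by
          nlinarith [hx1t ht₀.le, hx1t ht₁.le, (hxpos t₀).le, (hxpos t₁).le]
        have hlog2 : Real.log x ≤ 2 * x ^ (1 / 2 : ℝ) := by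
          have := Real.log_le_rpow_div hx0.le (show (0 : ℝ) < 1 / 2 by norm_num)
          linarith
        calc Real.log ((x ^ t₀ + 1) * (x ^ t₁ + 1)) ≤ Real.log (4 * (x ^ t₀ * x ^ t₁)) :=
              Real.log_le_log (by positivity) hle
          _ = Real.log 4 + (t₀ + t₁) * Real.log x := by
              rw [Real.log_mul (by norm_num) (by positivity), ← Real.rpow_add hx0,
                Real.log_rpow hx0]
          _ ≤ Real.log 4 + (t₀ + t₁) * (2 * x ^ (1 / 2 : ℝ)) := by
              gcongr
          _ = Real.log 4 + 2 * (t₀ + t₁) * x ^ (1 / 2 : ℝ) := by ring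
      -- T3 : x^t₀ log(e(1 + c x^s₁)) ≤ (1 + log(1+c)) x^t₀ + (s₁/ε) x^{t₀+ε}
      have hT3 : x ^ t₀ * Real.log (Real.exp 1 * (1 + c * x ^ s₁)) ≤
          (1 + Real.log (1 + c)) * x ^ t₀ + s₁ / ε * x ^ (t₀ + ε) := by
        have hle : 1 + c * x ^ s₁ ≤ (1 + c) * x ^ s₁ := by nlinarith [hx1t hs₁.le]
        have hlogε : Real.log x ≤ x ^ ε / ε := Real.log_le_rpow_div hx0.le hε0
        have hlc : 0 ≤ Real.log (1 + c) := Real.log_nonneg (by linarith)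
        calc x ^ t₀ * Real.log (Real.exp 1 * (1 + c * x ^ s₁))
            ≤ x ^ t₀ * Real.log (Real.exp 1 * ((1 + c) * x ^ s₁)) := by
              gcongr
          _ = x ^ t₀ * (1 + Real.log (1 + c) + s₁ * Real.log x) := by
              rw [Real.log_mul (Real.exp_pos 1).ne' (by positivity), Real.log_exp,
                Real.log_mul (by positivity) (hxpos s₁).ne', Real.log_rpow hx0]
              ring
          _ ≤ x ^ t₀ * (1 + Real.log (1 + c) + s₁ * (x ^ ε / ε)) := by
              gcongr
          _ = (1 + Real.log (1 + c)) * x ^ t₀ + s₁ / ε * x ^ (t₀ + ε) := by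
              rw [Real.rpow_add hx0]; field_simp
      -- T4 : e(1 + c x^s₁) x^t₁ = e x^t₁ + e c x^{s₁+t₁}
      have hT4 : Real.exp 1 * (1 + c * x ^ s₁) * x ^ t₁ =
          Real.exp 1 * x ^ t₁ + Real.exp 1 * c * x ^ (s₁ + t₁) := by
        rw [Real.rpow_add hx0]; ring
      have hx1' : x = x ^ (1 : ℝ) := (Real.rpow_one x).symm
      rw [hT4]
      have hx1'' : (1 : ℝ) * x ^ (1 : ℝ) = x := by rw [Real.rpow_one, one_mul]
      rw [hx1''] at E3
      linarith [hT1, hT3, E1, E2, E3, E4, E5, E6, E7, (hxpos u).le]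
    · -- (8U)² ≤ Δ T₀ T₁
      have hl : (8 * (2 * x ^ u)) ^ 2 = 256 * x ^ (2 * u) := by
        rw [mul_comm (2 : ℝ) u, Real.rpow_mul hx0.le, Real.rpow_two]; ring
      have hr : x * x ^ t₀ * x ^ t₁ = 1 * x ^ (1 + t₀ + t₁) := by
        rw [Real.rpow_add hx0, Real.rpow_add hx0, Real.rpow_one]; ring
      rw [hl, hr]; exact E8
    · -- k! e^{-2x^u} ≤ e^{-x^u}
      intro k hk
      have hb1 : 1 ≤ x ^ s₀ := hx1t hs₀.le
      have hkk : (k.factorial : ℝ) ≤ Real.exp (x ^ u) := by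
        calc (k.factorial : ℝ) ≤ (k : ℝ) ^ k := by exact_mod_cast Nat.factorial_le_pow k
          _ ≤ (x ^ s₀) ^ k := by gcongr
          _ = (x ^ s₀) ^ (k : ℝ) := (Real.rpow_natCast _ k).symm
          _ ≤ (x ^ s₀) ^ (x ^ s₀) := Real.rpow_le_rpow_of_exponent_le hb1 hk
          _ = Real.exp (s₀ * x ^ s₀ * Real.log x) := by
              rw [Real.rpow_def_of_pos (hxpos s₀), Real.log_rpow hx0]; ring_nf
          _ ≤ Real.exp (x ^ u) := by
              rw [Real.exp_le_exp]; simpa using E9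
      calc (k.factorial : ℝ) * Real.exp (-(2 * x ^ u))
          ≤ Real.exp (x ^ u) * Real.exp (-(2 * x ^ u)) := by gcongr
        _ = Real.exp (-x ^ u) := by rw [← Real.exp_add]; ring_nf
  exact tendsto_natCast_atTop_atTop.eventually H

/-! ### Roy 2001, §5, 2°: Conjecture 2 (rank `l`) implies Conjecture 1 (rank `l`) -/

/-- Roy 2001, §5, 2° (p. 193–194): with `α_j = e^{y_j}`, Theorem 3 (applied with `Δ = N`,
`r = 1 + cN^{s₁}`, `T₀ = N^{t₀}`, `T₁ = N^{t₁}`, `U = 2N^u`, `c = Σ|y_j|`) and Cauchy's inequalities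
produce the polynomials `P_N` required by the hypothesis of Conjecture 2.
[cite: Roy2001, §5 (2°)] -/
theorem royHypothesis_exp (h₃ : Roy2001_thm3) {l : ℕ} (y : Fin l → ℂ) {s₀ s₁ t₀ t₁ u : ℝ}
    (hadm : RoyAdmissible s₀ s₁ t₀ t₁ u) : RoyHypothesis y (cexp ∘ y) s₀ s₁ t₀ t₁ u := by
  set c : ℝ := ∑ j, ‖y j‖ with hc_def
  have hc : 0 ≤ c := Finset.sum_nonneg fun j _ => norm_nonneg _
  have ht₀ : 0 < t₀ := hadm.2.2.1
  have ht₁ : 0 < t₁ := hadm.2.2.2.1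
  filter_upwards [eventually_roy_params hadm hc, eventually_gt_atTop 0] with N hN hN0
  obtain ⟨hU, hmain, hprod, hfact⟩ := hN
  have hNpos : (0 : ℝ) < N := by exact_mod_cast hN0
  have hr : (0 : ℝ) < 1 + c * (N : ℝ) ^ s₁ := by positivity
  obtain ⟨P, hP0, hd0, hd1, hH, hval⟩ := h₃ (N : ℝ) (1 + c * (N : ℝ) ^ s₁) ((N : ℝ) ^ t₀)
    ((N : ℝ) ^ t₁) (2 * (N : ℝ) ^ u) hNpos hr (Real.rpow_pos_of_pos hNpos _)
    (Real.rpow_pos_of_pos hNpos _) hU hmain hprod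
  refine ⟨P, hP0, hd0, hd1, hH, fun k m hk hm => ?_⟩
  set z₀ : ℂ := ∑ j, (m j : ℂ) * y j with hz₀_def
  have hz₀ : ‖z₀‖ ≤ c * (N : ℝ) ^ s₁ := by
    calc ‖z₀‖ ≤ ∑ j, ‖(m j : ℂ) * y j‖ := norm_sum_le _ _
      _ ≤ ∑ j, (N : ℝ) ^ s₁ * ‖y j‖ := by
          refine Finset.sum_le_sum fun j _ => ?_
          rw [norm_mul, Complex.norm_natCast]
          exact mul_le_mul_of_nonneg_right (hm j) (norm_nonneg _)
      _ = c * (N : ℝ) ^ s₁ := by rw [hc_def, Finset.sum_mul]; simp [mul_comm]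
  have hpt : (![∑ j, (m j : ℂ) * y j, ∏ j, (cexp ∘ y) j ^ m j] : Fin 2 → ℂ) = ![z₀, cexp z₀] := by
    have : ∏ j, (cexp ∘ y) j ^ m j = cexp z₀ := by
      rw [hz₀_def, Complex.exp_sum]
      simp [Complex.exp_nat_mul]
    rw [this]
  have hsphere : ∀ z ∈ sphere z₀ 1, ‖expEval P z‖ ≤ Real.exp (-(2 * (N : ℝ) ^ u)) := by
    intro z hz
    refine hval z ?_
    have h1 : ‖z - z₀‖ = 1 := by simpa [dist_eq_norm] using hz
    calc ‖z‖ = ‖(z - z₀) + z₀‖ := by ring_nf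
      _ ≤ ‖z - z₀‖ + ‖z₀‖ := norm_add_le _ _
      _ ≤ 1 + c * (N : ℝ) ^ s₁ := by rw [h1]; gcongr
  rw [hpt]
  calc ‖aeval ![z₀, cexp z₀] (royD^[k] P)‖ = ‖expEval (royD^[k] P) z₀‖ := rfl
    _ ≤ k.factorial * Real.exp (-(2 * (N : ℝ) ^ u)) :=
        norm_expEval_iterate_royD_le k P z₀ hsphere
    _ ≤ Real.exp (-(N : ℝ) ^ u) := hfact k hk

/-- **Roy 2001, §5, 2°**: Theorem 3 (Waldschmidt) and Roy's Conjecture 2 for rank `l` imply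
Schanuel's conjecture for rank `l`. [cite: Roy2001, §5 (2°)] -/
theorem schanuelRank_of_royCriterion (h₃ : Roy2001_thm3) {l : ℕ} (h : RoyCriterion l) :
    SchanuelRank l := by
  intro y hy
  obtain ⟨s₀, s₁, t₀, t₁, u, hadm⟩ : ∃ s₀ s₁ t₀ t₁ u : ℝ, RoyAdmissible s₀ s₁ t₀ t₁ u :=
    ⟨_, _, _, _, _, royAdmissible_example⟩
  exact h y (cexp ∘ y) hy (fun j => Complex.exp_ne_zero _) s₀ s₁ t₀ t₁ u hadm
    (royHypothesis_exp h₃ y hadm)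

/-! ### Roy 2001, §5, 1°: Conjecture 1 (rank `l`) implies Conjecture 2 (rank `l`) -/

/-- The implication `(b) ⇒ (a)` of Theorem 1 for admissible parameters — the only part of
Theorem 1 used in §5, 1°. [cite: Roy2001, Thm. 1] -/
def RoyThm1BtoA : Prop :=
  ∀ (y α : ℂ), α ≠ 0 → ∀ (s₀ s₁ t₀ t₁ u : ℝ), RoyAdmissible s₀ s₁ t₀ t₁ u →
    RoyConditionB y α s₀ s₁ t₀ t₁ u → RoyConditionA y α

/-- `(b) ⇒ (a)` from Theorem 1. [cite: Roy2001, Thm. 1] -/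
theorem royThm1BtoA_of_thm1 (h : Roy2001_thm1) : RoyThm1BtoA :=
  fun y α hα s₀ s₁ t₀ t₁ u hadm hb => (h y α hα s₀ s₁ t₀ t₁ u hadm).2 hb

/-- `(b) ⇒ (a)` for admissible parameters from Proposition 3 alone (admissible parameters
satisfy `max{1, t₀, 2t₁} < min{s₀, 2s₁} ≤ s₀ < u`). [cite: Roy2001, Prop. 3] -/
theorem royThm1BtoA_of_prop3 (h₃ : Roy2001_prop3) : RoyThm1BtoA := by
  intro y α hα s₀ s₁ t₀ t₁ u hadm hb
  obtain ⟨hs₀, hs₁, ht₀, ht₁, hu, h1, h2, -⟩ := hadm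
  by_contra ha
  exact h₃ y α hα s₀ s₁ t₀ t₁ u hs₀ hs₁ ht₀ ht₁ hu h1
    (lt_of_le_of_lt (min_le_left _ _) (lt_of_le_of_lt (le_max_left _ _) h2)) ha hb

/-- Roy 2001, §5, 1° (first sentence): the hypothesis of Conjecture 2 for `(y, α)`, specialised
to `m = m·e_j`, is condition (b) of Theorem 1 for `(y_j, α_j)`. [cite: Roy2001, §5 (1°)] -/
theorem royConditionB_of_royHypothesis {l : ℕ} {y α : Fin l → ℂ} {s₀ s₁ t₀ t₁ u : ℝ}
    (h : RoyHypothesis y α s₀ s₁ t₀ t₁ u) (j : Fin l) :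
    RoyConditionB (y j) (α j) s₀ s₁ t₀ t₁ u := by
  refine h.mono fun N hN => ?_
  obtain ⟨P, hP0, hd0, hd1, hH, hval⟩ := hN
  refine ⟨P, hP0, hd0, hd1, hH, fun k m hk hm => ?_⟩
  have hm' : ∀ i, ((Pi.single j m : Fin l → ℕ) i : ℝ) ≤ (N : ℝ) ^ s₁ := by
    intro i
    by_cases hij : i = j
    · subst hij; simpa using hm
    · rw [Pi.single_eq_of_ne hij]; simpa using Real.rpow_nonneg (Nat.cast_nonneg N) s₁
  have := hval k (Pi.single j m) hk hm'
  have hpt : (![∑ i, ((Pi.single j m : Fin l → ℕ) i : ℂ) * y i,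
      ∏ i, α i ^ (Pi.single j m : Fin l → ℕ) i] : Fin 2 → ℂ) = ![(m : ℂ) * y j, α j ^ m] := by
    have hs : ∑ i, ((Pi.single j m : Fin l → ℕ) i : ℂ) * y i = (m : ℂ) * y j := by
      rw [Finset.sum_eq_single j (fun i _ hij => by rw [Pi.single_eq_of_ne hij]; simp)
        (fun hj => absurd (Finset.mem_univ j) hj)]
      simp
    have hp : ∏ i, α i ^ (Pi.single j m : Fin l → ℕ) i = α j ^ m := by
      rw [Finset.prod_eq_single j (fun i _ hij => by rw [Pi.single_eq_of_ne hij]; simp)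
        (fun hj => absurd (Finset.mem_univ j) hj)]
      simp
    rw [hs, hp]
  rwa [hpt] at this

/-- **Roy 2001, §5, 1°**: Theorem 1 (`(b) ⇒ (a)`) and Schanuel's conjecture for rank `l` imply
Roy's Conjecture 2 for rank `l`: Theorem 1 gives `d ≥ 1` with `α_j^d = e^{d y_j}` for all `j`;
`d y_1, …, d y_l` are linearly independent, so `tr.deg ℚ(dy, α^d) ≥ l`, and
`ℚ(dy, α^d) ⊆ ℚ(y, α)`. [cite: Roy2001, §5 (1°)] -/
theorem royCriterion_of_schanuelRank (h₁ : RoyThm1BtoA) {l : ℕ} (hS : SchanuelRank l) :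
    RoyCriterion l := by
  intro y α hy hα s₀ s₁ t₀ t₁ u hadm hhyp
  have hd : ∀ j, RoyConditionA (y j) (α j) := fun j =>
    h₁ (y j) (α j) (hα j) s₀ s₁ t₀ t₁ u hadm (royConditionB_of_royHypothesis hhyp j)
  choose d hd1 hd2 using hd
  set D : ℕ := ∏ j, d j with hD
  have hD0 : 0 < D := Finset.prod_pos fun j _ => hd1 j
  have hαD : ∀ j, α j ^ D = cexp (D * y j) := by
    intro j
    obtain ⟨e, he⟩ : d j ∣ D := Finset.dvd_prod_of_mem _ (Finset.mem_univ j)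
    rw [he, pow_mul, hd2 j, ← Complex.exp_nat_mul]
    push_cast; ring_nf
  set y' : Fin l → ℂ := fun j => (D : ℂ) * y j with hy'_def
  have hy' : LinearIndependent ℚ y' := by
    have hDq : (D : ℚ) ≠ 0 := by exact_mod_cast hD0.ne'
    have := hy.units_smul (fun _ => Units.mk0 (D : ℚ) hDq)
    convert this using 1
    ext j
    simp [hy'_def, Units.smul_def, Rat.smul_def]
  have hle : IntermediateField.adjoin ℚ (Set.range y' ∪ Set.range (cexp ∘ y')) ≤
      IntermediateField.adjoin ℚ (Set.range y ∪ Set.range α) := by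
    refine IntermediateField.adjoin_le_iff.mpr ?_
    rintro x (⟨j, rfl⟩ | ⟨j, rfl⟩)
    · exact mul_mem (natCast_mem _ D)
        (IntermediateField.subset_adjoin _ _ (Or.inl ⟨j, rfl⟩))
    · change cexp ((D : ℂ) * y j) ∈ _
      rw [← hαD j]
      exact pow_mem (IntermediateField.subset_adjoin ℚ (Set.range y ∪ Set.range α)
        (Or.inr ⟨j, rfl⟩)) D
  calc (l : Cardinal)
      ≤ Algebra.trdeg ℚ ↥(IntermediateField.adjoin ℚ (Set.range y' ∪ Set.range (cexp ∘ y'))) :=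
        hS y' hy'
    _ ≤ Algebra.trdeg ℚ ↥(IntermediateField.adjoin ℚ (Set.range y ∪ Set.range α)) :=
        trdeg_le_of_injective (IntermediateField.inclusion hle)
          (IntermediateField.inclusion_injective hle)

/-! ### Inputs of Proposition 3: Lemma 4 (proved) and the interpolation Theorem 2 (named fact) -/

/-- **Roy 2001, Lemma 4**: if `a ∈ ℂ` is irrational then for infinitely many positive integers
`N`, `min{|m + na| : m, n ∈ ℤ, 0 < max{|m|, |n|} < N} ≥ 1/(2N)`. [cite: Roy2001, Lemma 4] -/
theorem Roy2001_lemma4 {a : ℂ} (ha : ∀ q : ℚ, (q : ℂ) ≠ a) :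
    ∃ᶠ N : ℕ in atTop, ∀ m n : ℤ, (m ≠ 0 ∨ n ≠ 0) → |m| < N → |n| < N →
      1 / (2 * (N : ℝ)) ≤ ‖(m : ℂ) + n * a‖ := by
  rw [Filter.frequently_atTop]
  by_contra! H
  obtain ⟨N₁, hN₁⟩ := H
  -- work above `N₀ = max N₁ 2`
  set N₀ : ℕ := max N₁ 2 with hN₀_def
  have hN₀1 : N₁ ≤ N₀ := le_max_left _ _
  have hN₀2 : 2 ≤ N₀ := le_max_right _ _
  have H' : ∀ N, N₀ ≤ N → ∃ m n : ℤ, (m ≠ 0 ∨ n ≠ 0) ∧ |m| < N ∧ |n| < N ∧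
      ‖(m : ℂ) + n * a‖ < 1 / (2 * (N : ℝ)) := fun N hN => hN₁ N (hN₀1.trans hN)
  choose! m n hmn hm hn hlt using H'
  -- Step 1: `n N ≠ 0`.
  have hn0 : ∀ N, N₀ ≤ N → n N ≠ 0 := by
    intro N hN h0
    have hm0 : m N ≠ 0 := (hmn N hN).resolve_right (fun h => h h0)
    have h1 : (1 : ℝ) ≤ ‖(m N : ℂ) + n N * a‖ := by
      rw [h0]; push_cast; rw [zero_mul, add_zero, Complex.norm_intCast]
      exact_mod_cast Int.one_le_abs hm0
    have h2 : 1 / (2 * (N : ℝ)) ≤ 1 / 4 := by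
      have : (2 : ℝ) ≤ N := by exact_mod_cast hN₀2.trans hN
      exact one_div_le_one_div_of_le (by norm_num) (by linarith)
    linarith [hlt N hN]
  -- Step 2: `m N n (N+1) = m (N+1) n N`.
  have hcross : ∀ N, N₀ ≤ N → m N * n (N + 1) = m (N + 1) * n N := by
    intro N hN
    have hN' : N₀ ≤ N + 1 := hN.trans (Nat.le_succ N)
    have hNpos : (0 : ℝ) < N := by exact_mod_cast (show 0 < N by omega)
    set k : ℤ := m N * n (N + 1) - m (N + 1) * n N with hk
    have hkC : (k : ℂ) = ((m N : ℂ) + n N * a) * n (N + 1) - ((m (N + 1) : ℂ) + n (N + 1) * a) * n N := by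
      rw [hk]; push_cast; ring
    have hn1 : ‖(n (N + 1) : ℂ)‖ ≤ N := by
      rw [Complex.norm_intCast]
      have := hn (N + 1) hN'
      have : |n (N + 1)| ≤ N := by push_cast at this; omega
      exact_mod_cast this
    have hn2 : ‖(n N : ℂ)‖ ≤ N := by
      rw [Complex.norm_intCast]
      exact_mod_cast (hn N hN).le
    have hkabs : ‖(k : ℂ)‖ < 1 := by
      rw [hkC]
      calc ‖((m N : ℂ) + n N * a) * n (N + 1) - ((m (N + 1) : ℂ) + n (N + 1) * a) * n N‖
          ≤ ‖((m N : ℂ) + n N * a) * n (N + 1)‖ + ‖((m (N + 1) : ℂ) + n (N + 1) * a) * n N‖ :=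
            norm_sub_le _ _
        _ = ‖(m N : ℂ) + n N * a‖ * ‖(n (N + 1) : ℂ)‖ +
              ‖(m (N + 1) : ℂ) + n (N + 1) * a‖ * ‖(n N : ℂ)‖ := by rw [norm_mul, norm_mul]
        _ ≤ 1 / (2 * (N : ℝ)) * N + 1 / (2 * ((N + 1 : ℕ) : ℝ)) * N := by
            gcongr
            · exact (hlt N hN).le
            · exact (hlt (N + 1) hN').le
        _ < 1 := by
            have h1 : 1 / (2 * (N : ℝ)) * N = 1 / 2 := by field_simp
            have h2 : 1 / (2 * ((N + 1 : ℕ) : ℝ)) * N < 1 / 2 := by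
              push_cast
              rw [div_mul_eq_mul_div, one_mul, div_lt_iff₀ (by positivity)]; linarith
            linarith
    have hk0 : k = 0 := by
      rw [Complex.norm_intCast] at hkabs
      exact Int.abs_lt_one_iff.1 (by exact_mod_cast hkabs)
    linarith [hk0]
  -- Step 3: the ratio `m N / n N` is constant, equal to `q = m N₀ / n N₀`.
  set q : ℚ := (m N₀ : ℚ) / n N₀ with hq
  have hratio : ∀ N, N₀ ≤ N → ((m N : ℚ) / n N) = q := by
    intro N hN
    induction N, hN using Nat.le_induction with
    | base => rfl
    | succ N hN ih =>
      rw [← ih]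
      have h1 : (n N : ℚ) ≠ 0 := by exact_mod_cast hn0 N hN
      have h2 : (n (N + 1) : ℚ) ≠ 0 := by exact_mod_cast hn0 (N + 1) (hN.trans (Nat.le_succ N))
      rw [div_eq_div_iff h2 h1]
      exact_mod_cast (hcross N hN).symm
  -- Step 4: `|q + a| < 1/(2N)` for all `N ≥ N₀`, hence `a = -q`.
  have hqa : ∀ N, N₀ ≤ N → ‖(q : ℂ) + a‖ < 1 / (2 * (N : ℝ)) := by
    intro N hN
    have hnN : (n N : ℂ) ≠ 0 := by exact_mod_cast hn0 N hN
    have hqN : (q : ℂ) = (m N : ℂ) / n N := by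
      rw [← hratio N hN]; push_cast; rfl
    have hfac : (m N : ℂ) + n N * a = n N * ((q : ℂ) + a) := by
      rw [hqN]; field_simp
    have h1 : (1 : ℝ) ≤ ‖(n N : ℂ)‖ := by
      rw [Complex.norm_intCast]; exact_mod_cast Int.one_le_abs (hn0 N hN)
    have h2 := hlt N hN
    rw [hfac, norm_mul] at h2
    calc ‖(q : ℂ) + a‖ ≤ ‖(n N : ℂ)‖ * ‖(q : ℂ) + a‖ :=
          le_mul_of_one_le_left (norm_nonneg _) h1
      _ < 1 / (2 * (N : ℝ)) := h2
  have hqa0 : ‖(q : ℂ) + a‖ ≤ 0 := by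
    refine le_of_forall_pos_lt_add fun ε hε => ?_
    obtain ⟨N, hN⟩ := exists_nat_gt (max (N₀ : ℝ) (1 / ε))
    have hNN₀ : N₀ ≤ N := by exact_mod_cast ((le_max_left _ _).trans_lt hN).le
    have hNε : 1 / ε < N := (le_max_right _ _).trans_lt hN
    have hNpos : (0 : ℝ) < N := lt_trans (by positivity) hNε
    have : 1 / (2 * (N : ℝ)) < ε := by
      rw [div_lt_iff₀ (by positivity)]
      rw [div_lt_iff₀ hε] at hNε
      linarith
    linarith [hqa N hNN₀]
  have : (q : ℂ) + a = 0 := norm_le_zero_iff.1 hqa0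
  exact ha (-q) (by push_cast; linear_combination -this)

/-- The sup of `|F|` on the torus `|z₁| = |z₂| = R` (Roy 2001, p. 185: `|F|_R`); `0` if unbounded.
[cite: Roy2001, §1 (p. 185)] -/
def torusSup (F : ℂ × ℂ → ℂ) (R : ℝ) : ℝ :=
  sSup ((fun z => ‖F z‖) '' {z : ℂ × ℂ | ‖z.1‖ = R ∧ ‖z.2‖ = R})

/-- The `k`-th iterate of the derivation `D_w = w₁ ∂/∂z₁ + w₂ ∂/∂z₂` applied to `F` at `p`,
written as `d^k/dt^k F(p + t w)|_{t=0}` (equal to Roy's `D_w^k F(p)` for `F` holomorphic near `p`)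
(Roy 2001, p. 184). [cite: Roy2001, §1 (p. 184)] -/
def dirIteratedDeriv (w : ℂ × ℂ) (k : ℕ) (F : ℂ × ℂ → ℂ) (p : ℂ × ℂ) : ℂ :=
  iteratedDeriv k (fun t : ℂ => F (p + t • w)) 0

/-- NAMED FACT — **Roy 2001, Theorem 2** (interpolation on `ℂ²`): let `{u, w}` be a basis of
`ℂ²`, `v ∈ ℂ²`, and `a ∈ ℂ` with `v - a u ∈ ℂ w`. There is `c ≥ 1` (depending on `u, v, w`) with
`u, v ∈ B(0, c)` such that for every integer `N ≥ 1` with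
`min{|m + na| : (m, n) ∈ ℤ², 0 < max{|m|, |n|} < N} ≥ 2^{-N}` (2), all real `r, R` with `R ≥ 2r`,
`r ≥ cN`, and every `F` continuous on `B(0, R)` and holomorphic inside,
`|F|_r ≤ (cr/N)^{N²} max_{0 ≤ k < N², 0 ≤ m, n < N} |D_w^k F(mu + nv)| N^k / k! + (cr/R)^{N²} |F|_R`
(display of Thm. 2, p. 185; as used on p. 193: `|F|_r ≤ c^{2N²} e^N A + e^{-N²} |F|_R`).
`B(0, R)` is the closed bidisc, i.e. the closed ball of the sup norm on `ℂ × ℂ`; the `max` is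
rendered as "for every upper bound `B` of these finitely many numbers".
[cite: Roy2001, Thm. 2] -/
def Roy2001_thm2 : Prop :=
  ∀ (u v w : ℂ × ℂ) (a : ℂ), LinearIndependent ℂ ![u, w] → v - a • u ∈ Submodule.span ℂ {w} →
    ∃ c : ℝ, 1 ≤ c ∧ ‖u‖ ≤ c ∧ ‖v‖ ≤ c ∧
      ∀ N : ℕ, 1 ≤ N →
        (∀ m n : ℤ, (m ≠ 0 ∨ n ≠ 0) → |m| < N → |n| < N →
          (2 : ℝ) ^ (-(N : ℤ)) ≤ ‖(m : ℂ) + n * a‖) →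
        ∀ r R : ℝ, 2 * r ≤ R → c * N ≤ r →
        ∀ F : ℂ × ℂ → ℂ, DiffContOnCl ℂ F (Metric.ball 0 R) →
        ∀ B : ℝ, (∀ k m n : ℕ, k < N ^ 2 → m < N → n < N →
            ‖dirIteratedDeriv w k F ((m : ℂ) • u + (n : ℂ) • v)‖ * (N : ℝ) ^ k / k.factorial ≤ B) →
          torusSup F r ≤
            (c * r / N) ^ (N ^ 2) * B + (c * r / R) ^ (N ^ 2) * torusSup F R

/-! ### Assembly (Roy 2001, §5) -/

/-- **Roy 2001, §5** — the equivalence of Conjectures 1 and 2 for each rank `l`, *conditionally*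
on the two analytic inputs of the printed proof: Theorem 3 (Waldschmidt's auxiliary polynomial)
and the implication `(b) ⇒ (a)` of Theorem 1. [cite: Roy2001, §5] -/
theorem Roy2001_iff_of' (h₃ : Roy2001_thm3) (h₁ : RoyThm1BtoA) : Roy2001_iff := fun _ =>
  ⟨schanuelRank_of_royCriterion h₃, royCriterion_of_schanuelRank h₁⟩

/-- **Roy 2001, §5** from Theorem 3 and Theorem 1. [cite: Roy2001, §5] -/
theorem Roy2001_iff_of (h₃ : Roy2001_thm3) (h₁ : Roy2001_thm1) : Roy2001_iff :=
  Roy2001_iff_of' h₃ (royThm1BtoA_of_thm1 h₁)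

/-- **Roy 2001, §5** from Theorem 3 and Proposition 3 (the minimal set of printed inputs).
[cite: Roy2001, §5] -/
theorem Roy2001_iff_of_thm3_of_prop3 (h₃ : Roy2001_thm3) (h : Roy2001_prop3) : Roy2001_iff :=
  Roy2001_iff_of' h₃ (royThm1BtoA_of_prop3 h)

/-! ### An auxiliary polynomial à la Waldschmidt, with weaker constants (proved)

Roy's Theorem 3 (`Roy2001_thm3`, Waldschmidt 1981 Thm. 3.1) is used in §5, 2° only through the
polynomials `P_N` it produces for `Δ = N`, `r = 1 + cN^{s₁}`, `T₀ = N^{t₀}`, `T₁ = N^{t₁}`,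
`U = 2N^u`.  Because the admissible window (1) is open, such polynomials also come out of the
classical Thue–Siegel construction (Siegel's lemma `Int.Matrix.exists_ne_zero_int_vec_norm_le`,
vanishing of the first `L ≍ N^λ` Taylor coefficients of `P(z, e^z)` at `0` with
`u < λ < ½(1 + t₀ + t₁)`, and the Schwarz-lemma bound `|f|_r ≤ 2·2^{-L} |f|_{2r}`).  This is
`exists_royAuxPoly` below; it makes the direction `RoyCriterion l → SchanuelRank l`
unconditional (`schanuelRank_of_royCriterion'`). [folklore: Waldschmidt-type auxiliary function]
-/

section AuxPoly

-- The entrywise sup norm on matrices: the (non-global) instance under which Mathlib states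
-- Siegel's lemma `Int.Matrix.exists_ne_zero_int_vec_norm_le`; local to this section only.
attribute [local instance] Matrix.seminormedAddCommGroup

/-- Schwarz-lemma bound from vanishing Taylor coefficients: if `f` is entire, `f^{(n)}(0) = 0`
for `n < L` and `|f| ≤ C` on `|w| = R`, then `|f(z)| ≤ 2 · 2^{-L} C` for `|z| ≤ R/2`.
[folklore] -/
theorem norm_le_of_iteratedDeriv_eq_zero {f : ℂ → ℂ} (hf : Differentiable ℂ f) {L : ℕ}
    {R C : ℝ} (hR : 0 < R) (h0 : ∀ n < L, iteratedDeriv n f 0 = 0)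
    (hC : ∀ w ∈ sphere (0 : ℂ) R, ‖f w‖ ≤ C) {z : ℂ} (hz : ‖z‖ ≤ R / 2) :
    ‖f z‖ ≤ 2 * (1 / 2) ^ L * C := by
  have hsum := Complex.hasSum_taylorSeries_of_entire hf 0 z
  simp only [sub_zero] at hsum
  have hC0 : 0 ≤ C := by
    have hw : ((R : ℂ)) ∈ sphere (0 : ℂ) R := by simp [hR.le]
    exact (norm_nonneg _).trans (hC _ hw)
  set g : ℕ → ℝ := fun n => if n < L then 0 else C * (1 / 2) ^ n with hg
  have hg_sum : HasSum g (2 * (1 / 2) ^ L * C) := by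
    have h1 : HasSum (fun n => g (n + L)) (2 * (1 / 2) ^ L * C) := by
      have : (fun n => g (n + L)) = fun n => C * (1 / 2) ^ L * ((1 : ℝ) / 2) ^ n := by
        ext n; simp [hg, pow_add]; ring
      rw [this, show (2 * (1 / 2) ^ L * C : ℝ) = C * (1 / 2) ^ L * 2 by ring]
      exact hasSum_geometric_two.mul_left (C * (1 / 2) ^ L)
    have h2 : ∑ i ∈ Finset.range L, g i = 0 :=
      Finset.sum_eq_zero fun i hi => by simp [hg, Finset.mem_range.1 hi]
    have := (hasSum_nat_add_iff L).1 h1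
    rwa [h2, add_zero] at this
  refine hsum.norm_le_of_bounded hg_sum fun n => ?_
  by_cases hn : n < L
  · simp [hg, hn, h0 n hn]
  · have hcauchy := Complex.norm_iteratedDeriv_le_of_forall_mem_sphere_norm_le (f := f) n hR
      hf.diffContOnCl hC
    have hzR : ‖z‖ / R ≤ 1 / 2 := by
      rw [div_le_iff₀ hR]; linarith
    simp only [hg, hn, if_false]
    calc ‖(n.factorial : ℂ)⁻¹ • z ^ n • iteratedDeriv n f 0‖
        = (n.factorial : ℝ)⁻¹ * (‖z‖ ^ n * ‖iteratedDeriv n f 0‖) := by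
          rw [norm_smul, norm_smul, norm_inv, Complex.norm_natCast, norm_pow]
      _ ≤ (n.factorial : ℝ)⁻¹ * (‖z‖ ^ n * (n.factorial * C / R ^ n)) := by gcongr
      _ = C * (‖z‖ / R) ^ n := by
          have : (n.factorial : ℝ) ≠ 0 := by positivity
          rw [div_pow]
          field_simp
      _ ≤ C * (1 / 2) ^ n := by gcongr

/-- The monomial `X₀^a X₁^b`. [folklore] -/
def monoXY (a b : ℕ) : MvPolynomial (Fin 2) ℤ := X 0 ^ a * X 1 ^ b

/-- The exponent vector of `X₀^a X₁^b` for `(a, b)` in the box `[0, T₀] × [0, T₁]`. [folklore] -/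
def boxExp {T₀ T₁ : ℕ} (ab : Fin (T₀ + 1) × Fin (T₁ + 1)) : Fin 2 →₀ ℕ :=
  Finsupp.single 0 (ab.1 : ℕ) + Finsupp.single 1 (ab.2 : ℕ)

/-- The `X₀`-exponent of `boxExp`. [folklore] -/
@[simp] theorem boxExp_zero {T₀ T₁ : ℕ} (ab : Fin (T₀ + 1) × Fin (T₁ + 1)) :
    boxExp ab 0 = ab.1 := by simp [boxExp]

/-- The `X₁`-exponent of `boxExp`. [folklore] -/
@[simp] theorem boxExp_one {T₀ T₁ : ℕ} (ab : Fin (T₀ + 1) × Fin (T₁ + 1)) :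
    boxExp ab 1 = ab.2 := by simp [boxExp]

/-- `boxExp` is injective. [folklore] -/
theorem boxExp_injective {T₀ T₁ : ℕ} :
    Function.Injective (boxExp (T₀ := T₀) (T₁ := T₁)) := by
  intro x y h
  have h0 := congrArg (fun m => m 0) h
  have h1 := congrArg (fun m => m 1) h
  simp only [boxExp_zero, boxExp_one] at h0 h1
  exact Prod.ext (Fin.ext h0) (Fin.ext h1)

/-- `C c · X₀^a X₁^b` is the monomial with exponent `boxExp (a, b)` and coefficient `c`.
[folklore] -/
theorem C_mul_monoXY_eq_monomial {T₀ T₁ : ℕ} (c : ℤ) (ab : Fin (T₀ + 1) × Fin (T₁ + 1)) :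
    C c * monoXY ab.1 ab.2 = monomial (boxExp ab) c := by
  simp only [monoXY, boxExp, X_pow_eq_monomial, monomial_mul, C_apply, mul_one, zero_add]

/-- The polynomial `Σ_{(a,b)} t(a,b) X₀^a X₁^b` with coefficient vector `t` on the box.
[folklore] -/
def polyOfCoeffs {T₀ T₁ : ℕ} (t : Fin (T₀ + 1) × Fin (T₁ + 1) → ℤ) : MvPolynomial (Fin 2) ℤ :=
  ∑ ab, C (t ab) * monoXY ab.1 ab.2

/-- `polyOfCoeffs t` as a sum of monomials. [folklore] -/
theorem polyOfCoeffs_eq_sum_monomial {T₀ T₁ : ℕ} (t : Fin (T₀ + 1) × Fin (T₁ + 1) → ℤ) :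
    polyOfCoeffs t = ∑ ab, monomial (boxExp ab) (t ab) := by
  simp only [polyOfCoeffs, C_mul_monoXY_eq_monomial]

/-- The coefficients of `polyOfCoeffs t` inside the box are the `t(a,b)`. [folklore] -/
theorem coeff_polyOfCoeffs {T₀ T₁ : ℕ} (t : Fin (T₀ + 1) × Fin (T₁ + 1) → ℤ)
    (ab : Fin (T₀ + 1) × Fin (T₁ + 1)) : coeff (boxExp ab) (polyOfCoeffs t) = t ab := by
  rw [polyOfCoeffs_eq_sum_monomial, coeff_sum, Finset.sum_eq_single ab]
  · simp
  · intro b _ hb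
    simp [coeff_monomial, boxExp_injective.ne hb]
  · intro h; exact absurd (Finset.mem_univ ab) h

/-- Outside the box the coefficients of `polyOfCoeffs t` vanish. [folklore] -/
theorem coeff_polyOfCoeffs_eq_zero {T₀ T₁ : ℕ} (t : Fin (T₀ + 1) × Fin (T₁ + 1) → ℤ)
    (m : Fin 2 →₀ ℕ) (hm : ∀ ab : Fin (T₀ + 1) × Fin (T₁ + 1), boxExp ab ≠ m) :
    coeff m (polyOfCoeffs t) = 0 := by
  rw [polyOfCoeffs_eq_sum_monomial, coeff_sum]
  exact Finset.sum_eq_zero fun ab _ => by rw [coeff_monomial, if_neg (hm ab)]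

/-- Every coefficient of `polyOfCoeffs t` is bounded by `‖t‖`. [folklore] -/
theorem natAbs_coeff_polyOfCoeffs_le {T₀ T₁ : ℕ} (t : Fin (T₀ + 1) × Fin (T₁ + 1) → ℤ)
    (m : Fin 2 →₀ ℕ) : ((coeff m (polyOfCoeffs t)).natAbs : ℝ) ≤ ‖t‖ := by
  by_cases h : ∃ ab : Fin (T₀ + 1) × Fin (T₁ + 1), boxExp ab = m
  · obtain ⟨ab, rfl⟩ := h
    rw [coeff_polyOfCoeffs]
    have := norm_le_pi_norm t ab
    rw [Int.norm_eq_abs] at this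
    rw [Nat.cast_natAbs]; exact_mod_cast this
  · rw [not_exists] at h
    rw [coeff_polyOfCoeffs_eq_zero t m h]
    simp

/-- The height of `polyOfCoeffs t` is at most `‖t‖`. [folklore] -/
theorem mvPolyHeight_polyOfCoeffs_le {T₀ T₁ : ℕ} (t : Fin (T₀ + 1) × Fin (T₁ + 1) → ℤ) :
    (mvPolyHeight (polyOfCoeffs t) : ℝ) ≤ ‖t‖ := by
  have h : mvPolyHeight (polyOfCoeffs t) ≤ ⌊‖t‖⌋₊ := by
    refine Finset.sup_le fun m _ => Nat.le_floor ?_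
    exact natAbs_coeff_polyOfCoeffs_le t m
  calc (mvPolyHeight (polyOfCoeffs t) : ℝ) ≤ ⌊‖t‖⌋₊ := by exact_mod_cast h
    _ ≤ ‖t‖ := Nat.floor_le (norm_nonneg _)

/-- `polyOfCoeffs t ≠ 0` for `t ≠ 0`. [folklore] -/
theorem polyOfCoeffs_ne_zero {T₀ T₁ : ℕ} {t : Fin (T₀ + 1) × Fin (T₁ + 1) → ℤ} (ht : t ≠ 0) :
    polyOfCoeffs t ≠ 0 := by
  obtain ⟨ab, hab⟩ := Function.ne_iff.1 ht
  intro h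
  have := coeff_polyOfCoeffs t ab
  rw [h, coeff_zero] at this
  exact hab this.symm

/-- Partial degrees of `polyOfCoeffs t`: `deg_{X₀} ≤ T₀`. [folklore] -/
theorem degreeOf_polyOfCoeffs_fst {T₀ T₁ : ℕ} (t : Fin (T₀ + 1) × Fin (T₁ + 1) → ℤ) :
    (polyOfCoeffs t).degreeOf 0 ≤ T₀ := by
  rw [degreeOf_le_iff]
  intro m hm
  rw [mem_support_iff] at hm
  by_contra hlt
  refine hm (coeff_polyOfCoeffs_eq_zero t m fun ab h => ?_)
  have := congrArg (fun m => m 0) h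
  simp only [boxExp_zero] at this
  have hab : (ab.1 : ℕ) ≤ T₀ := Nat.lt_succ_iff.1 ab.1.isLt
  omega

/-- Partial degrees of `polyOfCoeffs t`: `deg_{X₁} ≤ T₁`. [folklore] -/
theorem degreeOf_polyOfCoeffs_snd {T₀ T₁ : ℕ} (t : Fin (T₀ + 1) × Fin (T₁ + 1) → ℤ) :
    (polyOfCoeffs t).degreeOf 1 ≤ T₁ := by
  rw [degreeOf_le_iff]
  intro m hm
  rw [mem_support_iff] at hm
  by_contra hlt
  refine hm (coeff_polyOfCoeffs_eq_zero t m fun ab h => ?_)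
  have := congrArg (fun m => m 1) h
  simp only [boxExp_one] at this
  have hab : (ab.2 : ℕ) ≤ T₁ := Nat.lt_succ_iff.1 ab.2.isLt
  omega

/-- `P(z, e^z)` for `P = X₀^a X₁^b` is `z^a e^{bz}`. [folklore] -/
theorem expEval_monoXY (a b : ℕ) (w : ℂ) : expEval (monoXY a b) w = w ^ a * cexp w ^ b := by
  simp [expEval, monoXY, map_mul, map_pow]

/-- `polyOfCoeffs t (z, e^z) = Σ t(a,b) z^a e^{bz}`. [folklore] -/
theorem expEval_polyOfCoeffs {T₀ T₁ : ℕ} (t : Fin (T₀ + 1) × Fin (T₁ + 1) → ℤ) (w : ℂ) :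
    expEval (polyOfCoeffs t) w = ∑ ab, (t ab : ℂ) * (w ^ (ab.1 : ℕ) * cexp w ^ (ab.2 : ℕ)) := by
  simp [expEval, polyOfCoeffs, monoXY, map_sum, map_mul, map_pow]

/-- On `|w| = R ≥ 1`: `|Σ t(a,b) w^a e^{bw}| ≤ (T₀+1)(T₁+1) ‖t‖ R^{T₀} e^{T₁ R}`. [folklore] -/
theorem norm_expEval_polyOfCoeffs_le {T₀ T₁ : ℕ} (t : Fin (T₀ + 1) × Fin (T₁ + 1) → ℤ)
    {R : ℝ} (hR : 1 ≤ R) (w : ℂ) (hw : w ∈ sphere (0 : ℂ) R) :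
    ‖expEval (polyOfCoeffs t) w‖ ≤
      ((T₀ + 1) * (T₁ + 1) : ℕ) * ‖t‖ * R ^ T₀ * Real.exp (T₁ * R) := by
  have hwR : ‖w‖ = R := by simpa using hw
  have hre : w.re ≤ R := hwR ▸ Complex.re_le_norm w
  rw [expEval_polyOfCoeffs]
  calc ‖∑ ab, (t ab : ℂ) * (w ^ (ab.1 : ℕ) * cexp w ^ (ab.2 : ℕ))‖
      ≤ ∑ ab, ‖(t ab : ℂ) * (w ^ (ab.1 : ℕ) * cexp w ^ (ab.2 : ℕ))‖ := norm_sum_le _ _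
    _ ≤ ∑ _ab : Fin (T₀ + 1) × Fin (T₁ + 1), ‖t‖ * R ^ T₀ * Real.exp (T₁ * R) := by
        refine Finset.sum_le_sum fun ab _ => ?_
        rw [norm_mul, norm_mul, norm_pow, norm_pow, Complex.norm_exp, hwR, Complex.norm_intCast]
        have h1 : |(t ab : ℝ)| ≤ ‖t‖ := by
          have := norm_le_pi_norm t ab
          rwa [Int.norm_eq_abs] at this
        have h2 : R ^ (ab.1 : ℕ) ≤ R ^ T₀ :=
          pow_le_pow_right₀ hR (Nat.lt_succ_iff.1 ab.1.isLt)
        have h3 : Real.exp w.re ^ (ab.2 : ℕ) ≤ Real.exp (T₁ * R) := by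
          rw [← Real.exp_nat_mul]
          refine Real.exp_le_exp.2 ?_
          have hb : ((ab.2 : ℕ) : ℝ) ≤ T₁ := by exact_mod_cast Nat.lt_succ_iff.1 ab.2.isLt
          calc ((ab.2 : ℕ) : ℝ) * w.re ≤ (ab.2 : ℕ) * R := by gcongr
            _ ≤ T₁ * R := by gcongr
        have h4 : 0 ≤ |(t ab : ℝ)| := abs_nonneg _
        calc |(t ab : ℝ)| * (R ^ (ab.1 : ℕ) * Real.exp w.re ^ (ab.2 : ℕ))
            ≤ ‖t‖ * (R ^ T₀ * Real.exp (T₁ * R)) := by gcongr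
          _ = ‖t‖ * R ^ T₀ * Real.exp (T₁ * R) := by ring
    _ = ((T₀ + 1) * (T₁ + 1) : ℕ) * ‖t‖ * R ^ T₀ * Real.exp (T₁ * R) := by
        rw [Finset.sum_const, Finset.card_univ, nsmul_eq_mul]
        simp [Fintype.card_prod, Fintype.card_fin, mul_assoc]

/-! #### Roy's derivation and Taylor coefficients at `0` -/

/-- `D (C c · P) = C c · D P`. [cite: Roy2001, §1] -/
theorem royD_C_mul (c : ℤ) (P : MvPolynomial (Fin 2) ℤ) : royD (C c * P) = C c * royD P := by
  rw [royD_mul, royD_C, zero_mul, zero_add]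

/-- `D` of a finite sum. [cite: Roy2001, §1] -/
theorem royD_sum {ι : Type*} (s : Finset ι) (f : ι → MvPolynomial (Fin 2) ℤ) :
    royD (∑ i ∈ s, f i) = ∑ i ∈ s, royD (f i) := by
  induction s using Finset.cons_induction with
  | empty => simp
  | cons a s ha ih => rw [Finset.sum_cons, royD_add, ih, Finset.sum_cons]

/-- `D^n (C c · P) = C c · D^n P`. [cite: Roy2001, §1] -/
theorem iterate_royD_C_mul (n : ℕ) (c : ℤ) (P : MvPolynomial (Fin 2) ℤ) :
    royD^[n] (C c * P) = C c * royD^[n] P := by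
  induction n generalizing P with
  | zero => rfl
  | succ n ih => rw [Function.iterate_succ_apply, royD_C_mul, ih, Function.iterate_succ_apply]

/-- `D^n` of a finite sum. [cite: Roy2001, §1] -/
theorem iterate_royD_sum {ι : Type*} (n : ℕ) (s : Finset ι) (f : ι → MvPolynomial (Fin 2) ℤ) :
    royD^[n] (∑ i ∈ s, f i) = ∑ i ∈ s, royD^[n] (f i) := by
  induction n generalizing f with
  | zero => rfl
  | succ n ih =>
    rw [Function.iterate_succ_apply, royD_sum, ih]
    simp only [Function.iterate_succ_apply]

/-- The `n`-th Taylor coefficient functional `P ↦ (D^n P)(0, 1) = (d/dz)^n P(z, e^z)|_{z=0}`,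
an integer. [folklore] -/
def taylorInt (n : ℕ) (P : MvPolynomial (Fin 2) ℤ) : ℤ :=
  eval ![0, 1] (royD^[n] P)

/-- Integer evaluation and complex evaluation agree. [folklore] -/
theorem intCast_eval (g : Fin 2 → ℤ) (Q : MvPolynomial (Fin 2) ℤ) :
    ((eval g Q : ℤ) : ℂ) = aeval (fun i => (g i : ℂ)) Q := by
  induction Q using MvPolynomial.induction_on with
  | C a => simp
  | add p q hp hq => simp [hp, hq]
  | mul_X p i hp => simp [hp]

/-- `taylorInt n P = (d/dz)^n P(z, e^z)|_{z=0}`. [folklore] -/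
theorem taylorInt_cast (n : ℕ) (P : MvPolynomial (Fin 2) ℤ) :
    (taylorInt n P : ℂ) = iteratedDeriv n (expEval P) 0 := by
  rw [iteratedDeriv_expEval, taylorInt, intCast_eval]
  simp only [expEval, Complex.exp_zero]
  congr 1
  ext i
  fin_cases i <;> simp

/-- `taylorInt n` on `polyOfCoeffs t` is the linear form `Σ t(a,b) · taylorInt n (X₀^a X₁^b)`.
[folklore] -/
theorem taylorInt_polyOfCoeffs {T₀ T₁ : ℕ} (n : ℕ) (t : Fin (T₀ + 1) × Fin (T₁ + 1) → ℤ) :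
    taylorInt n (polyOfCoeffs t) = ∑ ab, taylorInt n (monoXY ab.1 ab.2) * t ab := by
  simp only [taylorInt, polyOfCoeffs, iterate_royD_sum, iterate_royD_C_mul, map_sum, map_mul,
    eval_C]
  exact Finset.sum_congr rfl fun ab _ => mul_comm _ _

/-- The matrix of the `L` Taylor-coefficient equations in the `(T₀+1)(T₁+1)` unknown
coefficients. [folklore] -/
def taylorMatrix (L T₀ T₁ : ℕ) : Matrix (Fin L) (Fin (T₀ + 1) × Fin (T₁ + 1)) ℤ :=
  Matrix.of fun n ab => taylorInt n (monoXY ab.1 ab.2)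

/-- `(A t)_n = taylorInt n (polyOfCoeffs t)`: the Taylor equations are `A t = 0`. [folklore] -/
theorem taylorMatrix_mulVec {L T₀ T₁ : ℕ} (t : Fin (T₀ + 1) × Fin (T₁ + 1) → ℤ) (n : Fin L) :
    (taylorMatrix L T₀ T₁ *ᵥ t) n = taylorInt n (polyOfCoeffs t) := by
  rw [taylorInt_polyOfCoeffs]
  simp [taylorMatrix, Matrix.mulVec, dotProduct]


/-- Entry bound: `|taylorInt n (X₀^a X₁^b)| ≤ n! e^b` (Cauchy on the unit circle). [folklore] -/
theorem abs_taylorInt_monoXY_le (n a b : ℕ) :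
    (|taylorInt n (monoXY a b)| : ℝ) ≤ n.factorial * Real.exp b := by
  have hC : ∀ w ∈ sphere (0 : ℂ) 1, ‖expEval (monoXY a b) w‖ ≤ Real.exp b := by
    intro w hw
    have hw1 : ‖w‖ = 1 := by simpa using hw
    rw [expEval_monoXY, norm_mul, norm_pow, norm_pow, hw1, one_pow, one_mul, Complex.norm_exp,
      ← Real.exp_nat_mul]
    refine Real.exp_le_exp.2 ?_
    have : w.re ≤ 1 := hw1 ▸ Complex.re_le_norm w
    calc (b : ℝ) * w.re ≤ b * 1 := by gcongr
      _ = b := mul_one _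
  have h := norm_expEval_iterate_royD_le n (monoXY a b) 0 hC
  have hcast : ‖expEval (royD^[n] (monoXY a b)) 0‖ = |(taylorInt n (monoXY a b) : ℝ)| := by
    rw [← iteratedDeriv_expEval, ← taylorInt_cast, Complex.norm_intCast]
  rw [← hcast]; exact h

/-- Norm bound for the Taylor matrix: `‖A‖ ≤ L^L e^{T₁}` (for `L ≥ 1`). [folklore] -/
theorem norm_taylorMatrix_le (L T₀ T₁ : ℕ) (hL : 1 ≤ L) :
    ‖taylorMatrix L T₀ T₁‖ ≤ (L : ℝ) ^ L * Real.exp T₁ := by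
  rw [Matrix.norm_le_iff (by positivity)]
  rintro n ⟨a, b⟩
  rw [taylorMatrix, Matrix.of_apply, Int.norm_eq_abs]
  have hb : ((b : ℕ) : ℝ) ≤ T₁ := by exact_mod_cast Nat.lt_succ_iff.1 b.isLt
  have hn : (n : ℕ) ≤ L := n.isLt.le
  have hfact : ((n : ℕ).factorial : ℝ) ≤ (L : ℝ) ^ L := by
    calc ((n : ℕ).factorial : ℝ) ≤ ((n : ℕ) : ℝ) ^ (n : ℕ) := by
          exact_mod_cast Nat.factorial_le_pow n
      _ ≤ (L : ℝ) ^ (n : ℕ) := by gcongr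
      _ ≤ (L : ℝ) ^ L := pow_le_pow_right₀ (by exact_mod_cast hL) hn
  calc (|taylorInt n (monoXY a b)| : ℝ) ≤ (n : ℕ).factorial * Real.exp b :=
        abs_taylorInt_monoXY_le n a b
    _ ≤ (L : ℝ) ^ L * Real.exp T₁ := by gcongr

/-! #### Parameter bookkeeping for the auxiliary polynomial -/

/-- The exponent `λ = (u + ½(1 + t₀ + t₁))/2` (so `u < λ < ½(1 + t₀ + t₁)`) governing the number
`L = ⌊N^λ⌋ + 1` of Taylor equations. [folklore] -/
def royLambda (t₀ t₁ u : ℝ) : ℝ := (u + (1 + t₀ + t₁) / 2) / 2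

/-- Numerical bookkeeping: for admissible parameters, `c ≥ 0` and large `N`, with
`T₀ = ⌊N^{t₀}⌋`, `T₁ = ⌊N^{t₁}⌋`, `L = ⌊N^λ⌋ + 1`, `M = (T₀+1)(T₁+1)`, `R = 2(1 + cN^{s₁})`:
`2L ≤ M`, the Siegel exponent bound `L/(M-L) · (log M + L log L + T₁) ≤ N`, and the smallness
bound `log 2 - L log 2 + log M + N + T₀ log R + T₁ R ≤ -2N^u`. [folklore] -/
theorem eventually_aux_params {s₀ s₁ t₀ t₁ u : ℝ} (h : RoyAdmissible s₀ s₁ t₀ t₁ u) {c : ℝ}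
    (hc : 0 ≤ c) :
    ∀ᶠ N : ℕ in atTop,
      2 * (⌊(N : ℝ) ^ royLambda t₀ t₁ u⌋₊ + 1) ≤ (⌊(N : ℝ) ^ t₀⌋₊ + 1) * (⌊(N : ℝ) ^ t₁⌋₊ + 1) ∧
      ((⌊(N : ℝ) ^ royLambda t₀ t₁ u⌋₊ + 1 : ℕ) : ℝ) /
          ((((⌊(N : ℝ) ^ t₀⌋₊ + 1) * (⌊(N : ℝ) ^ t₁⌋₊ + 1) : ℕ) : ℝ) -
            ((⌊(N : ℝ) ^ royLambda t₀ t₁ u⌋₊ + 1 : ℕ) : ℝ)) *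
        (Real.log (((⌊(N : ℝ) ^ t₀⌋₊ + 1) * (⌊(N : ℝ) ^ t₁⌋₊ + 1) : ℕ) : ℝ) +
          ((⌊(N : ℝ) ^ royLambda t₀ t₁ u⌋₊ + 1 : ℕ) : ℝ) *
            Real.log ((⌊(N : ℝ) ^ royLambda t₀ t₁ u⌋₊ + 1 : ℕ) : ℝ) +
          (⌊(N : ℝ) ^ t₁⌋₊ : ℝ)) ≤ N ∧
      Real.log 2 - ((⌊(N : ℝ) ^ royLambda t₀ t₁ u⌋₊ + 1 : ℕ) : ℝ) * Real.log 2 +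
          Real.log (((⌊(N : ℝ) ^ t₀⌋₊ + 1) * (⌊(N : ℝ) ^ t₁⌋₊ + 1) : ℕ) : ℝ) + N +
          (⌊(N : ℝ) ^ t₀⌋₊ : ℝ) * Real.log (2 * (1 + c * (N : ℝ) ^ s₁)) +
          (⌊(N : ℝ) ^ t₁⌋₊ : ℝ) * (2 * (1 + c * (N : ℝ) ^ s₁)) ≤ -(2 * (N : ℝ) ^ u) := by
  obtain ⟨hs₀, hs₁, ht₀, ht₁, hu, h1, h2, h3⟩ := h
  have hmax := max_lt_iff.1 h1
  have hmax' := max_lt_iff.1 hmax.2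
  have hmin1 := lt_min_iff.1 hmax.1
  have hmint₀ := lt_min_iff.1 hmax'.1
  have hmint₁ := lt_min_iff.1 hmax'.2
  have hs₀u : s₀ < u := lt_of_le_of_lt (le_max_left _ _) h2
  have hst : s₁ + t₁ < u := lt_of_le_of_lt (le_max_right _ _) h2
  have h1u : 1 < u := hmin1.1.trans hs₀u
  have ht₀u : t₀ < u := hmint₀.1.trans hs₀u
  have htt : 1 < t₀ + t₁ := by linarith
  have ht₁1 : t₁ < 1 := by linarith [hmint₀.2, hmint₁.2]
  set lam : ℝ := royLambda t₀ t₁ u with hlam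
  have hulam : u < lam := by rw [hlam, royLambda]; linarith
  have hlam2 : 2 * lam < 1 + t₀ + t₁ := by rw [hlam, royLambda]; linarith
  have hlamtt : lam < t₀ + t₁ := by linarith
  have hlamt₀ : lam - t₀ < 1 := by linarith
  have hlam0 : 0 < lam := hu.trans hulam
  have hμ : 2 * lam - t₀ - t₁ < 1 := by linarith
  have hneg : lam - t₀ - t₁ < 1 := by linarith
  have q5 : (0 : ℝ) < 1 / 5 := by norm_num
  have q2 : (0 : ℝ) < 1 / 2 := by norm_num
  have hl2 : 0 < Real.log 2 := Real.log_pos one_lt_two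
  have q8 : (0 : ℝ) < Real.log 2 / 8 := by positivity
  have H : ∀ᶠ x : ℝ in atTop,
      2 * ((⌊x ^ lam⌋₊ + 1 : ℕ) : ℝ) ≤ (((⌊x ^ t₀⌋₊ + 1) * (⌊x ^ t₁⌋₊ + 1) : ℕ) : ℝ) ∧
      ((⌊x ^ lam⌋₊ + 1 : ℕ) : ℝ) /
          ((((⌊x ^ t₀⌋₊ + 1) * (⌊x ^ t₁⌋₊ + 1) : ℕ) : ℝ) - ((⌊x ^ lam⌋₊ + 1 : ℕ) : ℝ)) *
        (Real.log (((⌊x ^ t₀⌋₊ + 1) * (⌊x ^ t₁⌋₊ + 1) : ℕ) : ℝ) +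
          ((⌊x ^ lam⌋₊ + 1 : ℕ) : ℝ) * Real.log ((⌊x ^ lam⌋₊ + 1 : ℕ) : ℝ) + (⌊x ^ t₁⌋₊ : ℝ)) ≤ x ∧
      Real.log 2 - ((⌊x ^ lam⌋₊ + 1 : ℕ) : ℝ) * Real.log 2 +
          Real.log (((⌊x ^ t₀⌋₊ + 1) * (⌊x ^ t₁⌋₊ + 1) : ℕ) : ℝ) + x +
          (⌊x ^ t₀⌋₊ : ℝ) * Real.log (2 * (1 + c * x ^ s₁)) +
          (⌊x ^ t₁⌋₊ : ℝ) * (2 * (1 + c * x ^ s₁)) ≤ -(2 * x ^ u) := by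
    filter_upwards [eventually_ge_atTop (1 : ℝ),
      -- (a)
      eventually_mul_rpow_le_mul_rpow 2 hlamtt q2,
      eventually_const_le_mul_rpow 2 (zero_lt_one.trans htt) q2,
      -- (b)
      eventually_mul_rpow_le_mul_rpow (4 * Real.log 4) hneg q5,
      eventually_mul_rpow_mul_log_le hneg (show (0 : ℝ) ≤ 4 * (t₀ + t₁) by linarith) q5,
      eventually_mul_rpow_le_mul_rpow (8 * Real.log 2) hμ q5,
      eventually_mul_rpow_mul_log_le hμ (show (0 : ℝ) ≤ 8 * lam by linarith) q5,
      eventually_mul_rpow_le_mul_rpow 4 hlamt₀ q5,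
      -- (c)
      eventually_const_le_mul_rpow (Real.log 2 + Real.log 4) hlam0 q8,
      eventually_mul_rpow_mul_log_le hlam0 (show (0 : ℝ) ≤ t₀ + t₁ by linarith) q8,
      eventually_mul_rpow_le_mul_rpow 1 (h1u.trans hulam) q8,
      eventually_mul_rpow_le_mul_rpow (Real.log (2 + 2 * c)) (ht₀u.trans hulam) q8,
      eventually_mul_rpow_mul_log_le (ht₀u.trans hulam) hs₁.le q8,
      eventually_mul_rpow_le_mul_rpow (2 + 2 * c) (hst.trans hulam) q8,
      eventually_mul_rpow_le_mul_rpow 2 hulam q8]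
      with x hx1 Ea1 Ea2 Eb1 Eb2 Eb3 Eb4 Eb5 Ec1 Ec2 Ec3 Ec4 Ec5 Ec6 Ec7
    have hx0 : 0 < x := one_pos.trans_le hx1
    have hxpos : ∀ s : ℝ, 0 < x ^ s := fun s => Real.rpow_pos_of_pos hx0 s
    have hx1t : ∀ {s : ℝ}, 0 ≤ s → 1 ≤ x ^ s := fun hs => Real.one_le_rpow hx1 hs
    have hlogx : 0 ≤ Real.log x := Real.log_nonneg hx1
    -- the integers
    set T₀ : ℕ := ⌊x ^ t₀⌋₊ with hT₀def
    set T₁ : ℕ := ⌊x ^ t₁⌋₊ with hT₁def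
    set L : ℕ := ⌊x ^ lam⌋₊ + 1 with hLdef
    have hT₀ : (T₀ : ℝ) ≤ x ^ t₀ := Nat.floor_le (hxpos t₀).le
    have hT₁ : (T₁ : ℝ) ≤ x ^ t₁ := Nat.floor_le (hxpos t₁).le
    have hT₀' : x ^ t₀ < T₀ + 1 := Nat.lt_floor_add_one _
    have hT₁' : x ^ t₁ < T₁ + 1 := Nat.lt_floor_add_one _
    have hLgt : x ^ lam < L := by rw [hLdef]; push_cast; exact Nat.lt_floor_add_one _
    have hLle : (L : ℝ) ≤ x ^ lam + 1 := by
      rw [hLdef]; push_cast; linarith [Nat.floor_le (hxpos lam).le]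
    have hL2 : (L : ℝ) ≤ 2 * x ^ lam := by linarith [hx1t hlam0.le]
    have hL1 : (1 : ℝ) ≤ L := by rw [hLdef]; push_cast; linarith [(Nat.cast_nonneg _ : (0:ℝ) ≤ ⌊x ^ lam⌋₊)]
    have hMdef : (((T₀ + 1) * (T₁ + 1) : ℕ) : ℝ) = ((T₀ : ℝ) + 1) * ((T₁ : ℝ) + 1) := by push_cast; ring
    set M : ℝ := (((T₀ + 1) * (T₁ + 1) : ℕ) : ℝ) with hMset
    have hMgt : x ^ (t₀ + t₁) < M := by
      rw [hMdef, Real.rpow_add hx0]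
      exact mul_lt_mul'' hT₀' hT₁' (hxpos _).le (hxpos _).le
    have hMle : M ≤ 4 * x ^ (t₀ + t₁) := by
      rw [hMdef, Real.rpow_add hx0]
      have h0 : (T₀ : ℝ) + 1 ≤ 2 * x ^ t₀ := by linarith [hx1t ht₀.le]
      have h1 : (T₁ : ℝ) + 1 ≤ 2 * x ^ t₁ := by linarith [hx1t ht₁.le]
      calc ((T₀ : ℝ) + 1) * ((T₁ : ℝ) + 1) ≤ (2 * x ^ t₀) * (2 * x ^ t₁) := by
            gcongr
        _ = 4 * (x ^ t₀ * x ^ t₁) := by ring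
    have hMpos : 0 < M := (hxpos _).trans hMgt
    have hM1 : 1 ≤ M := (hx1t (by linarith)).trans hMgt.le
    -- (a)
    have ha : 2 * (L : ℝ) ≤ M := by linarith
    refine ⟨ha, ?_, ?_⟩
    · -- (b)
      have hA : x ^ (lam - t₀ - t₁) * x ^ lam = x ^ (2 * lam - t₀ - t₁) := by
        rw [← Real.rpow_add hx0]; ring_nf
      have hB : x ^ (lam - t₀ - t₁) * x ^ t₁ = x ^ (lam - t₀) := by
        rw [← Real.rpow_add hx0]; ring_nf
      have hC : x ^ (lam - t₀ - t₁) * x ^ (t₀ + t₁) = x ^ lam := by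
        rw [← Real.rpow_add hx0]; ring_nf
      have he : (L : ℝ) / (M - L) ≤ 4 * x ^ (lam - t₀ - t₁) := by
        have hML : M / 2 ≤ M - L := by linarith
        calc (L : ℝ) / (M - L) ≤ L / (M / 2) := by
              exact div_le_div_of_nonneg_left (by linarith) (by linarith) hML
          _ = 2 * L / M := by field_simp
          _ ≤ 2 * (2 * x ^ lam) / x ^ (t₀ + t₁) := by
              exact div_le_div₀ (by positivity) (by linarith) (hxpos _) hMgt.le
          _ = 4 * x ^ (lam - t₀ - t₁) := by
              rw [← hC]; field_simp; ring
      have hS : Real.log M + L * Real.log L + T₁ ≤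
          Real.log 4 + (t₀ + t₁) * Real.log x + 2 * x ^ lam * (Real.log 2 + lam * Real.log x) +
            x ^ t₁ := by
        have h1 : Real.log M ≤ Real.log 4 + (t₀ + t₁) * Real.log x := by
          calc Real.log M ≤ Real.log (4 * x ^ (t₀ + t₁)) := Real.log_le_log hMpos hMle
            _ = Real.log 4 + (t₀ + t₁) * Real.log x := by
                rw [Real.log_mul (by norm_num) (hxpos _).ne', Real.log_rpow hx0]
        have h2 : (L : ℝ) * Real.log L ≤ 2 * x ^ lam * (Real.log 2 + lam * Real.log x) := by
          have hlogL : Real.log L ≤ Real.log 2 + lam * Real.log x := by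
            calc Real.log L ≤ Real.log (2 * x ^ lam) := Real.log_le_log (by linarith) hL2
              _ = Real.log 2 + lam * Real.log x := by
                  rw [Real.log_mul (by norm_num) (hxpos _).ne', Real.log_rpow hx0]
          have hlogL0 : 0 ≤ Real.log L := Real.log_nonneg hL1
          exact mul_le_mul hL2 hlogL hlogL0 (by positivity)
        linarith
      have hS0 : 0 ≤ Real.log M + L * Real.log L + T₁ := by
        have : 0 ≤ Real.log M := Real.log_nonneg hM1
        have : 0 ≤ (L : ℝ) * Real.log L := mul_nonneg (by linarith) (Real.log_nonneg hL1)
        positivity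
      have he0 : 0 ≤ (L : ℝ) / (M - L) := div_nonneg (by linarith) (by linarith)
      calc (L : ℝ) / (M - L) * (Real.log M + L * Real.log L + T₁)
          ≤ (4 * x ^ (lam - t₀ - t₁)) * (Real.log 4 + (t₀ + t₁) * Real.log x +
              2 * x ^ lam * (Real.log 2 + lam * Real.log x) + x ^ t₁) :=
            mul_le_mul he hS hS0 (by positivity)
        _ = 4 * Real.log 4 * x ^ (lam - t₀ - t₁) +
              4 * (t₀ + t₁) * x ^ (lam - t₀ - t₁) * Real.log x +
              8 * Real.log 2 * (x ^ (lam - t₀ - t₁) * x ^ lam) +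
              8 * lam * (x ^ (lam - t₀ - t₁) * x ^ lam) * Real.log x +
              4 * (x ^ (lam - t₀ - t₁) * x ^ t₁) := by ring
        _ ≤ x := by
            rw [hA, hB]
            have hx : x ^ (1 : ℝ) = x := Real.rpow_one x
            rw [hx] at Eb1 Eb2 Eb3 Eb4 Eb5
            linarith
    · -- (c)
      set R : ℝ := 2 * (1 + c * x ^ s₁) with hRdef
      have hcx : 0 ≤ c * x ^ s₁ := mul_nonneg hc (hxpos s₁).le
      have hR2 : 2 ≤ R := by rw [hRdef]; linarith
      have hRpos : 0 < R := by linarith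
      have hRle : R ≤ (2 + 2 * c) * x ^ s₁ := by
        have := hx1t hs₁.le
        rw [hRdef]; linarith
      have hlogR0 : 0 ≤ Real.log R := Real.log_nonneg (by linarith)
      have hlogR : Real.log R ≤ Real.log (2 + 2 * c) + s₁ * Real.log x := by
        calc Real.log R ≤ Real.log ((2 + 2 * c) * x ^ s₁) := Real.log_le_log hRpos hRle
          _ = Real.log (2 + 2 * c) + s₁ * Real.log x := by
              rw [Real.log_mul (by positivity) (hxpos _).ne', Real.log_rpow hx0]
      have h1 : Real.log M ≤ Real.log 4 + (t₀ + t₁) * Real.log x := by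
        calc Real.log M ≤ Real.log (4 * x ^ (t₀ + t₁)) := Real.log_le_log hMpos hMle
          _ = Real.log 4 + (t₀ + t₁) * Real.log x := by
              rw [Real.log_mul (by norm_num) (hxpos _).ne', Real.log_rpow hx0]
      have h2 : (T₀ : ℝ) * Real.log R ≤ x ^ t₀ * (Real.log (2 + 2 * c) + s₁ * Real.log x) :=
        mul_le_mul hT₀ hlogR hlogR0 (hxpos _).le
      have h3 : (T₁ : ℝ) * R ≤ (2 + 2 * c) * x ^ (s₁ + t₁) := by
        calc (T₁ : ℝ) * R ≤ x ^ t₁ * ((2 + 2 * c) * x ^ s₁) :=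
              mul_le_mul hT₁ hRle hRpos.le (hxpos _).le
          _ = (2 + 2 * c) * x ^ (s₁ + t₁) := by rw [Real.rpow_add hx0]; ring
      have h4 : -((L : ℝ) * Real.log 2) ≤ -(x ^ lam * Real.log 2) := by
        have := mul_le_mul_of_nonneg_right hLgt.le hl2.le
        linarith
      have hx : x ^ (1 : ℝ) = x := Real.rpow_one x
      have hx0' : x ^ (0 : ℝ) = 1 := Real.rpow_zero x
      rw [hx] at Ec3
      rw [hx0', mul_one] at Ec2
      linarith [h1, h2, h3, h4, Ec1, Ec2, Ec3, Ec4, Ec5, Ec6, Ec7, (hxpos lam).le,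
        (hxpos t₀).le, hlogx]
  refine (tendsto_natCast_atTop_atTop.eventually H).mono fun N hN => ⟨?_, hN.2.1, hN.2.2⟩
  exact_mod_cast hN.1

/-- **Auxiliary polynomial (Waldschmidt-type, weaker constants).** For admissible parameters,
`c ≥ 0` and every large `N` there is a non-zero `P_N ∈ ℤ[X₀, X₁]` with `deg_{X₀} P_N ≤ N^{t₀}`,
`deg_{X₁} P_N ≤ N^{t₁}`, height `≤ e^N` and `|P_N(z, e^z)| ≤ e^{-2N^u}` for `|z| ≤ 1 + cN^{s₁}` —
exactly what Roy 2001, §5, 2° extracts from Theorem 3. Proof: Siegel's lemma on the first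
`L = ⌊N^λ⌋ + 1` Taylor coefficients of `P(z, e^z)` at `0`, then the Schwarz-lemma bound.
[folklore: Thue–Siegel–Waldschmidt auxiliary function; cf. Roy2001, Thm. 3] -/
theorem exists_royAuxPoly {s₀ s₁ t₀ t₁ u : ℝ} (h : RoyAdmissible s₀ s₁ t₀ t₁ u) {c : ℝ}
    (hc : 0 ≤ c) :
    ∀ᶠ N : ℕ in atTop, ∃ P : MvPolynomial (Fin 2) ℤ, P ≠ 0 ∧
      (P.degreeOf 0 : ℝ) ≤ (N : ℝ) ^ t₀ ∧ (P.degreeOf 1 : ℝ) ≤ (N : ℝ) ^ t₁ ∧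
      (mvPolyHeight P : ℝ) ≤ Real.exp N ∧
      ∀ z : ℂ, ‖z‖ ≤ 1 + c * (N : ℝ) ^ s₁ → ‖expEval P z‖ ≤ Real.exp (-(2 * (N : ℝ) ^ u)) := by
  have hs₁ : 0 < s₁ := h.2.1
  filter_upwards [eventually_aux_params h hc, eventually_ge_atTop 1] with N hN hN1
  set x : ℝ := (N : ℝ) with hxdef
  set T₀ : ℕ := ⌊x ^ t₀⌋₊ with hT₀def
  set T₁ : ℕ := ⌊x ^ t₁⌋₊ with hT₁def
  set L : ℕ := ⌊x ^ royLambda t₀ t₁ u⌋₊ + 1 with hLdef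
  obtain ⟨hLM, hheight, hsmall⟩ := hN
  have hx1 : (1 : ℝ) ≤ x := by rw [hxdef]; exact_mod_cast hN1
  have hx0 : 0 < x := one_pos.trans_le hx1
  have hL1 : 1 ≤ L := Nat.succ_le_succ (Nat.zero_le _)
  have hLM' : L < (T₀ + 1) * (T₁ + 1) := by omega
  -- Siegel's lemma
  obtain ⟨t, ht0, hAt, htnorm⟩ := Int.Matrix.exists_ne_zero_int_vec_norm_le (taylorMatrix L T₀ T₁)
    (by simpa [Fintype.card_prod, Fintype.card_fin] using hLM') (by simp [Fintype.card_fin]; omega)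
  simp only [Fintype.card_prod, Fintype.card_fin] at htnorm
  set M : ℝ := (((T₀ + 1) * (T₁ + 1) : ℕ) : ℝ) with hMset
  have hMpos : 0 < M := by rw [hMset]; positivity
  have hM1 : 1 ≤ M := by rw [hMset]; exact_mod_cast Nat.one_le_iff_ne_zero.2 (by positivity)
  have hLM_real : (L : ℝ) ≤ M := by rw [hMset]; exact_mod_cast hLM'.le
  -- height
  have hnorm : ‖t‖ ≤ Real.exp N := by
    refine htnorm.trans ?_
    set X : ℝ := M * max 1 ‖taylorMatrix L T₀ T₁‖ with hX
    have hX1 : 1 ≤ X := one_le_mul_of_one_le_of_one_le hM1 (le_max_left _ _)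
    have hXpos : 0 < X := one_pos.trans_le hX1
    have he0 : 0 ≤ (L : ℝ) / (M - L) := div_nonneg (Nat.cast_nonneg _) (sub_nonneg.2 hLM_real)
    have hbnd : (1 : ℝ) ≤ (L : ℝ) ^ L * Real.exp T₁ :=
      one_le_mul_of_one_le_of_one_le (one_le_pow₀ (by exact_mod_cast hL1))
        (Real.one_le_exp (Nat.cast_nonneg _))
    have hlogX : Real.log X ≤ Real.log M + L * Real.log L + T₁ := by
      have hmax : max 1 ‖taylorMatrix L T₀ T₁‖ ≤ (L : ℝ) ^ L * Real.exp T₁ :=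
        max_le hbnd (norm_taylorMatrix_le L T₀ T₁ hL1)
      have hlm : Real.log (max 1 ‖taylorMatrix L T₀ T₁‖) ≤ L * Real.log L + T₁ := by
        calc Real.log (max 1 ‖taylorMatrix L T₀ T₁‖) ≤ Real.log ((L : ℝ) ^ L * Real.exp T₁) :=
              Real.log_le_log (lt_of_lt_of_le one_pos (le_max_left _ _)) hmax
          _ = L * Real.log L + T₁ := by
              rw [Real.log_mul (by positivity) (Real.exp_pos _).ne', Real.log_pow, Real.log_exp]
      rw [hX, Real.log_mul hMpos.ne' (lt_of_lt_of_le one_pos (le_max_left _ _)).ne']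
      linarith
    calc X ^ ((L : ℝ) / (M - L)) = Real.exp (Real.log X * ((L : ℝ) / (M - L))) :=
          Real.rpow_def_of_pos hXpos _
      _ ≤ Real.exp N := by
          refine Real.exp_le_exp.2 ?_
          calc Real.log X * ((L : ℝ) / (M - L)) = (L : ℝ) / (M - L) * Real.log X := mul_comm _ _
            _ ≤ (L : ℝ) / (M - L) * (Real.log M + L * Real.log L + T₁) :=
                mul_le_mul_of_nonneg_left hlogX he0
            _ ≤ N := hheight
  refine ⟨polyOfCoeffs t, polyOfCoeffs_ne_zero ht0, ?_, ?_, ?_, ?_⟩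
  · calc ((polyOfCoeffs t).degreeOf 0 : ℝ) ≤ T₀ := by exact_mod_cast degreeOf_polyOfCoeffs_fst t
      _ ≤ x ^ t₀ := Nat.floor_le (Real.rpow_nonneg hx0.le _)
  · calc ((polyOfCoeffs t).degreeOf 1 : ℝ) ≤ T₁ := by exact_mod_cast degreeOf_polyOfCoeffs_snd t
      _ ≤ x ^ t₁ := Nat.floor_le (Real.rpow_nonneg hx0.le _)
  · exact (mvPolyHeight_polyOfCoeffs_le t).trans hnorm
  · intro z hz
    set R : ℝ := 2 * (1 + c * x ^ s₁) with hRdef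
    have hr0 : 0 ≤ c * x ^ s₁ := mul_nonneg hc (Real.rpow_nonneg hx0.le _)
    have hR1 : 1 ≤ R := by rw [hRdef]; linarith
    have hRpos : 0 < R := one_pos.trans_le hR1
    -- vanishing of the first L Taylor coefficients
    have hvan : ∀ n < L, iteratedDeriv n (expEval (polyOfCoeffs t)) 0 = 0 := by
      intro n hn
      have h1 := congrFun hAt ⟨n, hn⟩
      rw [taylorMatrix_mulVec] at h1
      rw [← taylorInt_cast]
      simp only [Pi.zero_apply] at h1
      rw [h1]; simp
    have hCR : ∀ w ∈ sphere (0 : ℂ) R, ‖expEval (polyOfCoeffs t) w‖ ≤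
        M * ‖t‖ * R ^ T₀ * Real.exp (T₁ * R) := fun w hw =>
      norm_expEval_polyOfCoeffs_le t hR1 w hw
    have hzR : ‖z‖ ≤ R / 2 := by rw [hRdef]; linarith
    have hbound := norm_le_of_iteratedDeriv_eq_zero (differentiable_expEval _) hRpos hvan hCR hzR
    refine hbound.trans ?_
    have eL : ((1 : ℝ) / 2) ^ L = Real.exp (-((L : ℝ) * Real.log 2)) := by
      rw [Real.exp_neg, Real.exp_nat_mul, Real.exp_log two_pos, one_div, inv_pow]
    have eR : R ^ T₀ = Real.exp ((T₀ : ℝ) * Real.log R) := by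
      rw [Real.exp_nat_mul, Real.exp_log hRpos]
    calc 2 * ((1 : ℝ) / 2) ^ L * (M * ‖t‖ * R ^ T₀ * Real.exp (T₁ * R))
        ≤ 2 * ((1 : ℝ) / 2) ^ L * (M * Real.exp N * R ^ T₀ * Real.exp (T₁ * R)) := by gcongr
      _ = Real.exp (Real.log 2) * Real.exp (-((L : ℝ) * Real.log 2)) *
            (Real.exp (Real.log M) * Real.exp N * Real.exp ((T₀ : ℝ) * Real.log R) *
              Real.exp (T₁ * R)) := by
          rw [← eL, ← eR, Real.exp_log two_pos, Real.exp_log hMpos]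
      _ = Real.exp (Real.log 2 - L * Real.log 2 + Real.log M + N + T₀ * Real.log R + T₁ * R) := by
          simp only [sub_eq_add_neg, Real.exp_add]; ring
      _ ≤ Real.exp (-(2 * x ^ u)) := Real.exp_le_exp.2 hsmall

/-- Roy 2001, §5, 2° made unconditional: the hypothesis of Conjecture 2 holds for
`(y, e^{y})` and every admissible parameter choice. [cite: Roy2001, §5 (2°)] -/
theorem royHypothesis_exp' {l : ℕ} (y : Fin l → ℂ) {s₀ s₁ t₀ t₁ u : ℝ}
    (hadm : RoyAdmissible s₀ s₁ t₀ t₁ u) : RoyHypothesis y (cexp ∘ y) s₀ s₁ t₀ t₁ u := by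
  set c : ℝ := ∑ j, ‖y j‖ with hc_def
  have hc : 0 ≤ c := Finset.sum_nonneg fun j _ => norm_nonneg _
  filter_upwards [exists_royAuxPoly hadm hc, eventually_roy_params hadm hc] with N hN hN'
  obtain ⟨P, hP0, hd0, hd1, hH, hval⟩ := hN
  obtain ⟨-, -, -, hfact⟩ := hN'
  refine ⟨P, hP0, hd0, hd1, hH, fun k m hk hm => ?_⟩
  set z₀ : ℂ := ∑ j, (m j : ℂ) * y j with hz₀_def
  have hz₀ : ‖z₀‖ ≤ c * (N : ℝ) ^ s₁ := by
    calc ‖z₀‖ ≤ ∑ j, ‖(m j : ℂ) * y j‖ := norm_sum_le _ _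
      _ ≤ ∑ j, (N : ℝ) ^ s₁ * ‖y j‖ := by
          refine Finset.sum_le_sum fun j _ => ?_
          rw [norm_mul, Complex.norm_natCast]
          exact mul_le_mul_of_nonneg_right (hm j) (norm_nonneg _)
      _ = c * (N : ℝ) ^ s₁ := by rw [hc_def, Finset.sum_mul]; simp [mul_comm]
  have hpt : (![∑ j, (m j : ℂ) * y j, ∏ j, (cexp ∘ y) j ^ m j] : Fin 2 → ℂ) = ![z₀, cexp z₀] := by
    have : ∏ j, (cexp ∘ y) j ^ m j = cexp z₀ := by
      rw [hz₀_def, Complex.exp_sum]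
      simp [Complex.exp_nat_mul]
    rw [this]
  have hsphere : ∀ z ∈ sphere z₀ 1, ‖expEval P z‖ ≤ Real.exp (-(2 * (N : ℝ) ^ u)) := by
    intro z hz
    refine hval z ?_
    have h1 : ‖z - z₀‖ = 1 := by simpa [dist_eq_norm] using hz
    calc ‖z‖ = ‖(z - z₀) + z₀‖ := by ring_nf
      _ ≤ ‖z - z₀‖ + ‖z₀‖ := norm_add_le _ _
      _ ≤ 1 + c * (N : ℝ) ^ s₁ := by rw [h1]; gcongr
  rw [hpt]
  calc ‖aeval ![z₀, cexp z₀] (royD^[k] P)‖ = ‖expEval (royD^[k] P) z₀‖ := rfl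
    _ ≤ k.factorial * Real.exp (-(2 * (N : ℝ) ^ u)) :=
        norm_expEval_iterate_royD_le k P z₀ hsphere
    _ ≤ Real.exp (-(N : ℝ) ^ u) := hfact k hk

/-- **Roy 2001, §5, 2° (unconditional)**: Roy's Conjecture 2 for rank `l` implies Schanuel's
conjecture for rank `l`. [cite: Roy2001, §5 (2°)] -/
theorem schanuelRank_of_royCriterion' {l : ℕ} (h : RoyCriterion l) : SchanuelRank l := by
  intro y hy
  obtain ⟨s₀, s₁, t₀, t₁, u, hadm⟩ : ∃ s₀ s₁ t₀ t₁ u : ℝ, RoyAdmissible s₀ s₁ t₀ t₁ u :=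
    ⟨_, _, _, _, _, royAdmissible_example⟩
  exact h y (cexp ∘ y) hy (fun j => Complex.exp_ne_zero _) s₀ s₁ t₀ t₁ u hadm
    (royHypothesis_exp' y hadm)

end AuxPoly

/-- **Roy 2001, §5**, conditional only on the implication `(b) ⇒ (a)` of Theorem 1 (the
direction `→` being `schanuelRank_of_royCriterion'`). [cite: Roy2001, §5] -/
theorem Roy2001_iff_of_btoA (h₁ : RoyThm1BtoA) : Roy2001_iff := fun _ =>
  ⟨schanuelRank_of_royCriterion', royCriterion_of_schanuelRank h₁⟩

/-- **Roy 2001, §5** from Proposition 3 alone: `Roy2001_iff` follows from `Roy2001_prop3`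
(itself resting on the interpolation Theorem 2 and Lemma 4). [cite: Roy2001, §5] -/
theorem Roy2001_iff_of_prop3 (h : Roy2001_prop3) : Roy2001_iff :=
  Roy2001_iff_of_btoA (royThm1BtoA_of_prop3 h)

/-- **Roy 2001, §5** from Theorem 1 alone. [cite: Roy2001, §5] -/
theorem Roy2001_iff_of_thm1 (h₁ : Roy2001_thm1) : Roy2001_iff :=
  Roy2001_iff_of_btoA (royThm1BtoA_of_thm1 h₁)

end Literature.NumberTheory.Transcendental

end
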